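import Summits.QuantumFields.YangMills.Theorems.BalabanUVNodesN15CurvedGluingSmoothCutDressedGluedDefectGauged
import Summits.QuantumFields.YangMills.Theorems.BalabanUVNodesN15CurvedGluingSmoothCutDressedCutPerturbation
import Summits.QuantumFields.YangMills.Theorems.BalabanUVNodesN15CurvedGluingLocalGaugesSpeciesUN
import HarnessLib

/-!
# Route «BalabanUVNodes» (cluster K4 «SpineRates»), Track-A DAG node N15 = NE2, BACKGROUND LAYER — THE TWO-GRID η-DEFECT OF THE GLUED PROPAGATORS OF BAŁABAN's COVARIANT OPERATORS
# `Δ_{R_U} + P` AT GENUINE `U(N)` BACKGROUNDS ON BOTH GRIDS, FROM DRESSED SMOOTH-CUT CUBES EACH IN ITS OWN PAIR OF UNITARY SMALL-FIELD GAUGES ((3.34)–(3.35) with (3.42) ∕ Thm 3.14):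
# the two-grid per-cube-gauge capstone (file 48) with the gauges, the cube perturbations (the species of the transformed bond variables CUT to the cube + the cut nonlocal perturbations), their
# letters from LOCAL row letters and their η-defect from cut fits, both covariance identities, the far-defect rows and their η-defects, and the `W`-rows ALL DISCHARGED BY NAME
# (dag-n15-w2 `uN_localOp_species_form` ∕ `uN_siteGauge_orthogonal`, this seat's files 49–51)

Cell `pub-ymgap`, seat `pub-ymgap-dag-n15-w3` (WIDTH SEAT 3∕3 on node N15, director-ym №197 ∕ HUMAN RULING D-0149; plan `W-SEAT-START-LIST.md` §n15 item 3 «LG-vector + background layers at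
GENERAL small-field U» — fifty-third piece, the two-grid knit-ready corollary of this seat's g5 package 47–52).  `bears_on: R4∕N15 · K3⁸ SpineGivenEndpointR13SepCoPHV
(stmt-QuantumFields-27366; K3⁷ 20544 aside — KEY MAP v2)`.  Filed `--kind proof --supports stmt-QuantumFields-27366 --as helper` — COUNT-NEUTRAL.  Theorems only; 0 `def`, 0 `sorry`.
Imports BY NAME this seat's file 48 `…SmoothCutDressedGluedDefectGauged` (`hasMaj_idef_glueInv_smoothCutDressed_localGauges`), file 51 `…SmoothCutDressedCutPerturbation`
(`hasMaj_cutPert_structural_of_local`, `hasMaj_idef_cutPert_structural_of_local`; through it files 49∕50: `localOp_eq_cut_add_farDefect`, `hasMaj_mulOp_farDefect_smoothCutDressed`,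
`hasMaj_commOp_farDefect_structural`, `hasMaj_idef_commOp_farDefect_structural`, `hasMaj_idef_mulOp_farDefect_structural`, `hasMaj_idef_of_eq_zero`) and dag-n15-w2 g5
`…CurvedGluingLocalGaugesSpeciesUN` (`uN_localOp_species_form`; through it `uN_siteGauge_orthogonal`, `coordMat`, `covLapM`, `tCoefC`, `tCoefA`); nothing in the tree is modified,
no landed name re-declared.

WHAT.  Two grids `X` (spacing `η`, shifts `τ`) and `X′` (spacing `η′`, shifts `τ′`) over one block map `π : X′ → X`; on each, unitary bond variables `U`, `U′ ∈ U(m)`, trace-form coordinates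
`e` of `𝔲(m) ≅ ℝ^ι`, Bałaban's covariant operators `Δ_{R_U} + P`, `Δ′_{R_{U′}} + P′`; per cube `k` unitary site gauges `u_k` (coarse), `u′_k` (fine) (`W_k = coordMat e (Ad_{u_k})`, `W′_k`
likewise, fitting across `π` up to `o_W`), the transformed bond variables `u_kUu_kᴴ`, `u′_kU′u′_kᴴ` and their species `unstackM (tCoefC) (tCoefA)` ([B9] (3.52) in transporter form),
per-cube nonlocal perturbations `N_V k`, `N′_V k` with `M_{W_k}PM_{W_kᵀ} = N_L − N_V k`, `M_{W′_k}P′M_{W′_kᵀ} = N′_L − N′_V k` (displayed), the cube perturbations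
`Ṽ_k := M_{ψ_k}(species_k + N_V k∘pr₀)C_{χ_k}`, `Ṽ′_k` likewise, and their far defects `F_k := −((species_k + N_V k∘pr₀) − Ṽ_k)∘jet`, `F′_k`.
★★★ `uN_hasMaj_idef_glueInv_smoothCutDressed_localGauges`: the η-defect across `π` of the two glued propagators `𝒢′`, `𝒢` built from the dressed smooth-cut cubes at `Ṽ′_k`, `Ṽ_k` in the
gauges `W′_k`, `W_k` obeys file 48's bound `𝔇(𝒢′, 𝒢) ≤ C·e^{−(ρ₃−2σ)d}` with `θ_F ↦ θ_FB̄′c_r`, `ε_F ↦ 0`, `r_{FK} ↦ (θ_F(A_D + o·B̄′) + r_D B̄′)c_r`, `r_{FE} ↦ 0` (written out below).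
HYPOTHESES DISCHARGED relative to file 48 (sixteen slots): the gauges' orthogonality ×4 (`uN_siteGauge_orthogonal`), the covariance identities `hcov`, `hcov′` (`uN_localOp_species_form` +
`hP`∕`hP′` + file 49 `localOp_eq_cut_add_farDefect` + `pr₀∘jet = 1`), the cube perturbations' letters `hV`, `hV′` (file 51, from row sums of `tCoefC, tCoefA` of the transformed bond
variables bounded by `r_V` WHEREVER `χ_k ≠ 0` ∕ `χ′_k ≠ 0` — (3.35) on the cube only — and the cut nonlocal letters `R_N`, `r_V(1 + |J ⊕ J|) + R_N ≤ R`) and their η-defect `hDV` (file 51,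
from the cut fits `o_V` of the species coefficients across `π` and the defect `o_N` of the cut nonlocal parts, `o_V(1 + |J ⊕ J|) + o_N ≤ o`), the far-defect rows `hFX`, `hFX′` (file 49,
`= 0`), `hFK`, `hFK′` (file 50, from the far letters `(1 − M_ψ)N_VM_χ ≤ θ_Fe^{−ρ_Fd}`), their η-defects `hDFK` (file 50, from `θ_F` and the far two-grid defect `r_D`), `hDFX` (file 50,
`= 0`), and the `W`-rows `hW`, `hW′`, `hDW` (`W = 0 = W′`).  What stays DISPLAYED: file 45's per-cube rows on both grids (cut rows of `N_k`, `N′_k` and their defects, bumps and fits,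
partitions and fit, tail rows, `[N_L, M_h]` letters, flat locality, plateau), the gauge fit `o_W`, `hP`, `hP′`, the local species letters and fits, the letters of `N_V k`, `N′_V k` (cut ∕
far ∕ defects), the partitions' supports inside `ψ_k`, `χ_k`, `ψ′_k`, `χ′_k`, and the two smallness conditions.

HONEST FRAMING ∕ LIMITS.  Composition of LANDED theorems — the operator-level η-rate content of NE2 for Bałaban's covariant operators at genuine non-abelian backgrounds with (3.34)–(3.35)'s
per-cube gauges on both grids, as a CONDITIONAL statement over DISPLAYED rows on King's ∕ dag-n15-a's model carriers; the gauges `u_k`, `u′_k` with the (3.35) letters and fits of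
`u_kUu_kᴴ`, `u′_kU′u′_kᴴ` on the cube, Bałaban's `P`, `P′` and their conjugation laws, `N_V`'s letters and file 45's rows are HYPOTHESES with located producers (dag-n15-w2 g5's axial-gauge
∕ `U(N)`-fit files; [B9] (3.49)∕(3.68)∕(3.77); dag-n15-a ∕ dag-n15-c); nothing of [B5]∕[B6]∕[B9] asserted ((2.91)–(2.92), (2.133)–(2.136), (3.34)–(3.35), (3.42), (3.50)–(3.53), (3.62)–(3.65),
(3.76)–(3.77), Thm 3.14 = SHAPES ∕ TEMPLATE ∕ MECHANISM).  NE2⁺ NOT PRINTED, NOT proved; N15 NOT discharged; K3⁸ OPEN, skeleton v6 untouched; counts of record UNMOVED (typed 28∕28 ·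
discharged 5∕27); one finite 𝕋⁴ at fixed ε — NOT infinite volume, NOT OS on ℝ⁴, NOT a mass gap, NOT Clay; R4 closes the conditional finite-𝕋⁴ rung `BalabanLadder.UV` only.
Restate-immune (no Theses import).
-/

set_option autoImplicit false

noncomputable section
open scoped BigOperators Matrix Matrix.Norms.Frobenius
open Finset

namespace Summit.QuantumFields.YangMills.BalabanUVNodes.N15.CurvedSpecies

open Literature.MathematicalPhysics.QuantumFieldTheory.Balaban1983to89
open Literature.MathematicalPhysics.QuantumFieldTheory.Balaban1983to89.B11SectG (BlockNorm HasMaj RowSum hasMaj_zero)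
open Literature.MathematicalPhysics.QuantumFieldTheory.Balaban1983to89.B6RandomWalk (Triangle254)
open Literature.MathematicalPhysics.QuantumFieldTheory.Balaban1983to89.T4EtaRateDefect (idef idef_add)
open Literature.MathematicalPhysics.QuantumFieldTheory.Balaban1983to89.T4EtaRateCoeffDefect (pull)
open Literature.MathematicalPhysics.QuantumFieldTheory.Balaban1983to89.B6Prop26Gluing (mulOp mulOp_apply ind ind_nonneg ind_le_one)
open Summit.QuantumFields.YangMills.BalabanUVNodes.N15.MatrixSpecies (mmulOp liftBlk liftMap liftEquiv liftEquiv_apply liftEquiv_symm_apply coordMat)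
open Summit.QuantumFields.YangMills.BalabanUVNodes.N15.BackgroundLayer (fgrad bgrad fgradAdj stack projO blkPair liftPair bgPropV covLapM tCoefA tCoefC unstackM projO_none_comp_stack)
open Summit.QuantumFields.YangMills.BalabanUVNodes.N15.Gluing (commOp lapOp parametrix remainder glueInv)
open Literature.Barriers.QuantumFields (traceForm)

variable {X X' ι J K : Type} [Fintype X] [Fintype X'] [DecidableEq X] [DecidableEq X'] [Fintype ι] [DecidableEq ι] [Fintype J] [DecidableEq J] [Fintype K] {g : B6.Geometry}
  (blk : X → g.Site) (π : X' → X) (τ : J → X ≃ X) (τ' : J → X' ≃ X') {σ cr : ℝ}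
  {N : K → (X × ι → ℝ) →ₗ[ℝ] (X × ι → ℝ)} {N' : K → (X' × ι → ℝ) →ₗ[ℝ] (X' × ι → ℝ)} {NL : (X × ι → ℝ) →ₗ[ℝ] (X × ι → ℝ)} {NL' : (X' × ι → ℝ) →ₗ[ℝ] (X' × ι → ℝ)}
  {χX χtX ψX hX : K → X → ℝ} {χX' χtX' ψX' hX' : K → X' → ℝ} {Sk : K → Set g.Site} {hb : K → g.Site → ℝ}
  {β β₁ ct m₀ m₁ oχ oχ₁ oχ₂ δ : ℝ}

/-- ★ **THE COVARIANCE IDENTITY OF A CUBE's UNITARY GAUGE, IN CUT-PLUS-FAR FORM** (the `hcov` slots of files 47∕48 at a genuine `U(m)` background): for a unitary site gauge `u`,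
unitary bond variables `U` and `M_WPM_{Wᵀ} = N_L − N_V` (`W = coordMat e (Ad_u)`), `M_W(Δ_{R_U} + P)M_{Wᵀ} = (Σ∇*∇ + N_L − Ṽ∘jet) + F` with the cube perturbation
`Ṽ = M_ψ(species(uUuᴴ) + N_V∘pr₀)C_χ` and the far defect `F = −((species(uUuᴴ) + N_V∘pr₀) − Ṽ)∘jet` — dag-n15-w2 `uN_localOp_species_form` + file 49 `localOp_eq_cut_add_farDefect` +
`pr₀∘jet = 1`. [cite: Balaban1985BackgroundPropagators, (3.50)–(3.53) p.400, (3.62)–(3.65) pp.402–403 (mechanism); Balaban1984PropagatorsII, (2.91) p.239] -/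
theorem uN_localOp_eq_cut_add_farDefect {m : Type} [Fintype m] [DecidableEq m] (e : Matrix m m ℂ ≃L[ℝ] (ι → ℝ)) (u : X → Matrix m m ℂ) (U : J → X → Matrix m m ℂ)
    {P NL NV : (X × ι → ℝ) →ₗ[ℝ] (X × ι → ℝ)} (χ ψ : X → ℝ) (η : ℝ) (he : ∀ A B : Matrix m m ℂ, traceForm A B = e A ⬝ᵥ e B) (hu : ∀ x, (u x)ᴴ * u x = 1)
    (hP : mmulOp (fun x => coordMat e (ContinuousLinearMap.mulLeftRight ℝ (Matrix m m ℂ) (u x) (u x)ᴴ)) ∘ₗ P ∘ₗ mmulOp (fun x => (coordMat e (ContinuousLinearMap.mulLeftRight ℝ (Matrix m m ℂ) (u x) (u x)ᴴ))ᵀ) = NL - NV) :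
    mmulOp (fun x => coordMat e (ContinuousLinearMap.mulLeftRight ℝ (Matrix m m ℂ) (u x) (u x)ᴴ)) ∘ₗ (covLapM τ η (gaugePair τ (fun μ x => coordMat e (ContinuousLinearMap.mulLeftRight ℝ (Matrix m m ℂ) (U μ x) (U μ x)ᴴ))) + P) ∘ₗ mmulOp (fun x => (coordMat e (ContinuousLinearMap.mulLeftRight ℝ (Matrix m m ℂ) (u x) (u x)ᴴ))ᵀ) =
      (lapOp η⁻¹ (fun μ => liftEquiv (τ μ) ι) 0 + NL - (mulOp (fun p : X × ι => ψ p.1) ∘ₗ (unstackM (tCoefC η (gaugePair τ fun μ x => coordMat e (ContinuousLinearMap.mulLeftRight ℝ (Matrix m m ℂ) (u x * U μ x * (u (τ μ x))ᴴ) (u x * U μ x * (u (τ μ x))ᴴ)ᴴ)))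
            (tCoefA η (gaugePair τ fun μ x => coordMat e (ContinuousLinearMap.mulLeftRight ℝ (Matrix m m ℂ) (u x * U μ x * (u (τ μ x))ᴴ) (u x * U μ x * (u (τ μ x))ᴴ)ᴴ))) + NV ∘ₗ projO none) ∘ₗ mulOp (fun q : (X × ι) × Option (J ⊕ J) => χ q.1.1)) ∘ₗ stack LinearMap.id (fun j => Sum.elim (fun μ => fgrad η⁻¹ (liftEquiv (τ μ) ι)) (fun μ => bgrad η⁻¹ (liftEquiv (τ μ) ι)) j)) +
        (-(((unstackM (tCoefC η (gaugePair τ fun μ x => coordMat e (ContinuousLinearMap.mulLeftRight ℝ (Matrix m m ℂ) (u x * U μ x * (u (τ μ x))ᴴ) (u x * U μ x * (u (τ μ x))ᴴ)ᴴ)))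
            (tCoefA η (gaugePair τ fun μ x => coordMat e (ContinuousLinearMap.mulLeftRight ℝ (Matrix m m ℂ) (u x * U μ x * (u (τ μ x))ᴴ) (u x * U μ x * (u (τ μ x))ᴴ)ᴴ))) + NV ∘ₗ projO none) - mulOp (fun p : X × ι => ψ p.1) ∘ₗ (unstackM (tCoefC η (gaugePair τ fun μ x => coordMat e (ContinuousLinearMap.mulLeftRight ℝ (Matrix m m ℂ) (u x * U μ x * (u (τ μ x))ᴴ) (u x * U μ x * (u (τ μ x))ᴴ)ᴴ)))
            (tCoefA η (gaugePair τ fun μ x => coordMat e (ContinuousLinearMap.mulLeftRight ℝ (Matrix m m ℂ) (u x * U μ x * (u (τ μ x))ᴴ) (u x * U μ x * (u (τ μ x))ᴴ)ᴴ))) + NV ∘ₗ projO none) ∘ₗ mulOp (fun q : (X × ι) × Option (J ⊕ J) => χ q.1.1)) ∘ₗ stack LinearMap.id (fun j => Sum.elim (fun μ => fgrad η⁻¹ (liftEquiv (τ μ) ι)) (fun μ => bgrad η⁻¹ (liftEquiv (τ μ) ι)) j))) := by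
  rw [uN_localOp_species_form e τ u U η he hu P, hP, ← localOp_eq_cut_add_farDefect, LinearMap.add_comp, LinearMap.comp_assoc, projO_none_comp_stack, LinearMap.comp_id]
  abel
set_option maxHeartbeats 400000 in
/-- ★★★ **THE TWO-GRID η-DEFECT OF THE GLUED PROPAGATORS OF BAŁABAN's COVARIANT OPERATORS `Δ_{R_U} + P` (coarse, spacing `η`) AND `Δ′_{R_{U′}} + P′` (fine, spacing `η′`) FROM DRESSED
SMOOTH-CUT CUBES, EACH CUBE IN ITS OWN PAIR OF UNITARY SMALL-FIELD GAUGES**: p639415's two-grid capstone `hasMaj_idef_glueInv_smoothCutDressed_localGauges` with the per-cube gauges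
`W_k = coordMat e (Ad_{u_k})`, `W′_k = coordMat e (Ad_{u′_k})` of UNITARY site fields, the GLOBAL operators of the UNITARY bond variables `U`, `U′`, the cube perturbations = the species of
the transformed bond variables `u_kUu_kᴴ`, `u′_kU′u′_kᴴ` CUT to the cube plus the cut nonlocal perturbations, and SIXTEEN slots DISCHARGED BY NAME: the four orthogonality relations
(`uN_siteGauge_orthogonal`), both covariance identities (`uN_localOp_species_form` + `hP`∕`hP′`), the perturbations' letters from LOCAL row letters where `χ_k ≠ 0` ∕ `χ′_k ≠ 0` and their
η-defect from the cut fits (file 51), the four far-defect rows (files 49∕50) and their two η-defects (file 50), the three `W`-rows (`W = 0 = W′`).  Displayed: file 45's rows, the gauge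
fit `o_W`, `M_{W_k}PM_{W_kᵀ} = N_L − N_V k` (both grids), the (3.35) letters and fits, the letters ∕ far letters ∕ η-defects of `N_V`, the partitions' supports.
[cite: Balaban1985BackgroundPropagators, (3.34)–(3.35) p.396, (3.42) p.397, Thm 3.14 pp.426–427 (template), (3.50)–(3.53) p.400, (3.62)–(3.65) pp.402–403, (3.76)–(3.77) p.406 (mechanism);
Balaban1984PropagatorsII, (2.91) p.239, (2.133)–(2.136) p.247] -/
theorem uN_hasMaj_idef_glueInv_smoothCutDressed_localGauges {m : Type} [Fintype m] [DecidableEq m] (e : Matrix m m ℂ ≃L[ℝ] (ι → ℝ)) {u : K → X → Matrix m m ℂ} {u' : K → X' → Matrix m m ℂ}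
    {U : J → X → Matrix m m ℂ} {U' : J → X' → Matrix m m ℂ} {P : (X × ι → ℝ) →ₗ[ℝ] (X × ι → ℝ)} {P' : (X' × ι → ℝ) →ₗ[ℝ] (X' × ι → ℝ)} {NV : K → (X × ι → ℝ) →ₗ[ℝ] (X × ι → ℝ)}
    {NV' : K → (X' × ι → ℝ) →ₗ[ℝ] (X' × ι → ℝ)} (η η' : ℝ) (htri : Triangle254 g) (hd : ∀ a b : g.Site, 0 ≤ g.dist a b) (hd0 : ∀ y : g.Site, g.dist y y = 0)
    (hsymm : ∀ y y', g.dist y y' = g.dist y' y) (hrow : RowSum g σ cr) (hσ : 0 ≤ σ) (hcr : 0 ≤ cr)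
    {ρ₁ ρ₂ ρ₃ ρN ρT δV ε R o c₁ c₂ o₁ o₂ rW θW cN rN ℓ ω d₁ oo ε₀ rF Nov oW : ℝ} (hβ : 0 ≤ β) (hβ₁ : 0 ≤ β₁) (hct : 0 ≤ ct) (hm₀ : 0 ≤ m₀) (hm₁ : 0 ≤ m₁)
    (hoχ : 0 ≤ oχ) (hoχ₁ : 0 ≤ oχ₁) (hoχ₂ : 0 ≤ oχ₂) (hR : 0 ≤ R) (ho : 0 ≤ o) (hσρ : σ ≤ ρ₁) (hρ₁V : ρ₁ ≤ δV) (hρ₁G : ρ₁ + σ ≤ δ) (hρ₂ : 0 ≤ ρ₂) (hρ₂₁ : ρ₂ + σ ≤ ρ₁)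
    (hρ₂T : ρ₂ + σ ≤ ρT) (hρ₃ : 0 ≤ ρ₃) (hρ₃₂ : ρ₃ ≤ ρ₂) (hρ₃V : ρ₃ + σ ≤ δV - ε) (hρ₃N : ρ₃ + σ ≤ ρN) (hσρ₃ : 2 * σ ≤ ρ₃) (hε : 0 < ε) (hc₁ : 0 ≤ c₁) (hc₂ : 0 ≤ c₂)
    (ho₁ : 0 ≤ o₁) (ho₂ : 0 ≤ o₂) (hrW : 0 ≤ rW) (hθW : 0 ≤ θW) (hcN : 0 ≤ cN) (hrN : 0 ≤ rN) (hℓ : 0 ≤ ℓ) (hω : 0 ≤ ω) (hd₁ : 0 ≤ d₁) (hoo : 0 ≤ oo) (hε₀ : 0 ≤ ε₀)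
    (hrF : 0 ≤ rF) (hNov : 0 ≤ Nov) (hn : 0 < η⁻¹) (hn' : 0 < η'⁻¹)
    (hSχ : ∀ k, ∀ x, (χX k) x ≠ 0 → blk x ∈ (Sk k)) (hSψ : ∀ k, ∀ x, (ψX k) x ≠ 0 → blk x ∈ (Sk k)) (hSχ' : ∀ k, ∀ x', (χX' k) x' ≠ 0 → blk (π x') ∈ (Sk k)) (hSψ' : ∀ k, ∀ x', (ψX' k) x' ≠ 0 → blk (π x') ∈ (Sk k))
    -- coarse bump data
    (hχt : ∀ k, ∀ x, |(χtX k) x| ≤ 1)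
    (hdχt : ∀ k, ∀ μ p, |fgrad η⁻¹ (liftEquiv (τ μ) ι) (fun p : X × ι => (χtX k) p.1) p| ≤ ct) (hdχtb : ∀ k, ∀ μ p, |bgrad η⁻¹ (liftEquiv (τ μ) ι) (fun p : X × ι => (χtX k) p.1) p| ≤ ct)
    (hsub : ∀ k, mulOp (fun p : X × ι => (χtX k) p.1) ∘ₗ mulOp (fun p : X × ι => (χX k) p.1) = mulOp (fun p : X × ι => (χtX k) p.1))
    (hχ : ∀ k, mulOp (fun p : X × ι => (χX k) p.1) ∘ₗ mulOp (fun p : X × ι => (χtX k) p.1) = mulOp (fun p : X × ι => (χtX k) p.1))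
    (hs : ∀ k, ∀ μ, mulOp ((fun p : X × ι => (χtX k) p.1) ∘ (liftEquiv (τ μ) ι)) ∘ₗ mulOp (fun p : X × ι => (χX k) p.1) = mulOp ((fun p : X × ι => (χtX k) p.1) ∘ (liftEquiv (τ μ) ι)))
    (hsb : ∀ k, ∀ μ, mulOp ((fun p : X × ι => (χtX k) p.1) ∘ (liftEquiv (τ μ) ι).symm) ∘ₗ mulOp (fun p : X × ι => (χX k) p.1) = mulOp ((fun p : X × ι => (χtX k) p.1) ∘ (liftEquiv (τ μ) ι).symm))
    (hdd : ∀ k, ∀ μ, mulOp (fgrad η⁻¹ (liftEquiv (τ μ) ι) (fun p : X × ι => (χtX k) p.1)) ∘ₗ mulOp (fun p : X × ι => (χX k) p.1) = mulOp (fgrad η⁻¹ (liftEquiv (τ μ) ι) (fun p : X × ι => (χtX k) p.1)))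
    (hddb : ∀ k, ∀ μ, mulOp (bgrad η⁻¹ (liftEquiv (τ μ) ι) (fun p : X × ι => (χtX k) p.1)) ∘ₗ mulOp (fun p : X × ι => (χX k) p.1) = mulOp (bgrad η⁻¹ (liftEquiv (τ μ) ι) (fun p : X × ι => (χtX k) p.1)))
    (hNψ : ∀ k, (N k) ∘ₗ mulOp (fun p : X × ι => (ψX k) p.1) = (N k))
    -- fine bump data
    (hχt' : ∀ k, ∀ x', |(χtX' k) x'| ≤ 1)
    (hdχt' : ∀ k, ∀ μ p', |fgrad η'⁻¹ (liftEquiv (τ' μ) ι) (fun p' : X' × ι => (χtX' k) p'.1) p'| ≤ ct) (hdχtb' : ∀ k, ∀ μ p', |bgrad η'⁻¹ (liftEquiv (τ' μ) ι) (fun p' : X' × ι => (χtX' k) p'.1) p'| ≤ ct)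
    (hsub' : ∀ k, mulOp (fun p : X' × ι => (χtX' k) p.1) ∘ₗ mulOp (fun p : X' × ι => (χX' k) p.1) = mulOp (fun p : X' × ι => (χtX' k) p.1))
    (hχ' : ∀ k, mulOp (fun p : X' × ι => (χX' k) p.1) ∘ₗ mulOp (fun p : X' × ι => (χtX' k) p.1) = mulOp (fun p : X' × ι => (χtX' k) p.1))
    (hs' : ∀ k, ∀ μ, mulOp ((fun p' : X' × ι => (χtX' k) p'.1) ∘ (liftEquiv (τ' μ) ι)) ∘ₗ mulOp (fun p' : X' × ι => (χX' k) p'.1) = mulOp ((fun p' : X' × ι => (χtX' k) p'.1) ∘ (liftEquiv (τ' μ) ι)))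
    (hsb' : ∀ k, ∀ μ, mulOp ((fun p' : X' × ι => (χtX' k) p'.1) ∘ (liftEquiv (τ' μ) ι).symm) ∘ₗ mulOp (fun p' : X' × ι => (χX' k) p'.1) =
      mulOp ((fun p' : X' × ι => (χtX' k) p'.1) ∘ (liftEquiv (τ' μ) ι).symm))
    (hdd' : ∀ k, ∀ μ, mulOp (fgrad η'⁻¹ (liftEquiv (τ' μ) ι) (fun p' : X' × ι => (χtX' k) p'.1)) ∘ₗ mulOp (fun p' : X' × ι => (χX' k) p'.1) = mulOp (fgrad η'⁻¹ (liftEquiv (τ' μ) ι) (fun p' : X' × ι => (χtX' k) p'.1)))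
    (hddb' : ∀ k, ∀ μ, mulOp (bgrad η'⁻¹ (liftEquiv (τ' μ) ι) (fun p' : X' × ι => (χtX' k) p'.1)) ∘ₗ mulOp (fun p' : X' × ι => (χX' k) p'.1) = mulOp (bgrad η'⁻¹ (liftEquiv (τ' μ) ι) (fun p' : X' × ι => (χtX' k) p'.1)))
    (hNψ' : ∀ k, (N' k) ∘ₗ mulOp (fun p : X' × ι => (ψX' k) p.1) = (N' k))
    -- fits of the bumps across `π`
    (hfitχ : ∀ k, ∀ x', |(χtX' k) x' - (χtX k) (π x')| ≤ oχ)
    (hfit₁ : ∀ k, ∀ μ p', |((fun p' : X' × ι => (χtX' k) p'.1) ∘ (liftEquiv (τ' μ) ι)) p' - ((fun p : X × ι => (χtX k) p.1) ∘ (liftEquiv (τ μ) ι)) (liftMap π ι p')| ≤ oχ₁)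
    (hfit₁b : ∀ k, ∀ μ p', |((fun p' : X' × ι => (χtX' k) p'.1) ∘ (liftEquiv (τ' μ) ι).symm) p' - ((fun p : X × ι => (χtX k) p.1) ∘ (liftEquiv (τ μ) ι).symm) (liftMap π ι p')| ≤ oχ₁)
    (hfit₂ : ∀ k, ∀ μ p', |fgrad η'⁻¹ (liftEquiv (τ' μ) ι) (fun p' : X' × ι => (χtX' k) p'.1) p' - fgrad η⁻¹ (liftEquiv (τ μ) ι) (fun p : X × ι => (χtX k) p.1) (liftMap π ι p')| ≤ oχ₂)
    (hfit₂b : ∀ k, ∀ μ p', |bgrad η'⁻¹ (liftEquiv (τ' μ) ι) (fun p' : X' × ι => (χtX' k) p'.1) p' - bgrad η⁻¹ (liftEquiv (τ μ) ι) (fun p : X × ι => (χtX k) p.1) (liftMap π ι p')| ≤ oχ₂)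
    -- cut rows and their defects
    (hcut : ∀ k, HasMaj (BlockNorm.ofBlocks g (liftBlk blk ι)) (BlockNorm.ofBlocks g (liftBlk blk ι)) (mulOp (fun p : X × ι => (χX k) p.1) ∘ₗ (N k))
      (fun y y' => ind (Sk k) y * ind (Sk k) y' * (β * Real.exp (-(δ * g.dist y y')))))
    (hcutF : ∀ k, ∀ μ, HasMaj (BlockNorm.ofBlocks g (liftBlk blk ι)) (BlockNorm.ofBlocks g (liftBlk blk ι)) (mulOp (fun p : X × ι => (χX k) p.1) ∘ₗ (fgrad η⁻¹ (liftEquiv (τ μ) ι) ∘ₗ (N k)))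
      (fun y y' => ind (Sk k) y * ind (Sk k) y' * (β₁ * Real.exp (-(δ * g.dist y y')))))
    (hcutB : ∀ k, ∀ μ, HasMaj (BlockNorm.ofBlocks g (liftBlk blk ι)) (BlockNorm.ofBlocks g (liftBlk blk ι)) (mulOp (fun p : X × ι => (χX k) p.1) ∘ₗ (bgrad η⁻¹ (liftEquiv (τ μ) ι) ∘ₗ (N k)))
      (fun y y' => ind (Sk k) y * ind (Sk k) y' * (β₁ * Real.exp (-(δ * g.dist y y')))))
    (hcut' : ∀ k, HasMaj (BlockNorm.ofBlocks g (liftBlk (blk ∘ π) ι)) (BlockNorm.ofBlocks g (liftBlk (blk ∘ π) ι)) (mulOp (fun p : X' × ι => (χX' k) p.1) ∘ₗ (N' k))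
      (fun y y' => ind (Sk k) y * ind (Sk k) y' * (β * Real.exp (-(δ * g.dist y y')))))
    (hcutF' : ∀ k, ∀ μ, HasMaj (BlockNorm.ofBlocks g (liftBlk (blk ∘ π) ι)) (BlockNorm.ofBlocks g (liftBlk (blk ∘ π) ι)) (mulOp (fun p : X' × ι => (χX' k) p.1) ∘ₗ (fgrad η'⁻¹ (liftEquiv (τ' μ) ι) ∘ₗ (N' k)))
      (fun y y' => ind (Sk k) y * ind (Sk k) y' * (β₁ * Real.exp (-(δ * g.dist y y')))))
    (hcutB' : ∀ k, ∀ μ, HasMaj (BlockNorm.ofBlocks g (liftBlk (blk ∘ π) ι)) (BlockNorm.ofBlocks g (liftBlk (blk ∘ π) ι)) (mulOp (fun p : X' × ι => (χX' k) p.1) ∘ₗ (bgrad η'⁻¹ (liftEquiv (τ' μ) ι) ∘ₗ (N' k)))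
      (fun y y' => ind (Sk k) y * ind (Sk k) y' * (β₁ * Real.exp (-(δ * g.dist y y')))))
    (hDcut : ∀ k, HasMaj (BlockNorm.ofBlocks g (liftBlk blk ι)) (BlockNorm.ofBlocks g (liftBlk blk ι ∘ liftMap π ι))
      (idef (pull (liftMap π ι)) (pull (liftMap π ι)) (mulOp (fun p : X' × ι => (χX' k) p.1) ∘ₗ (N' k)) (mulOp (fun p : X × ι => (χX k) p.1) ∘ₗ (N k)))
      (fun y y' => ind (Sk k) y * ind (Sk k) y' * (m₀ * Real.exp (-(δ * g.dist y y')))))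
    (hDcutF : ∀ k, ∀ μ, HasMaj (BlockNorm.ofBlocks g (liftBlk blk ι)) (BlockNorm.ofBlocks g (liftBlk blk ι ∘ liftMap π ι))
      (idef (pull (liftMap π ι)) (pull (liftMap π ι)) (mulOp (fun p : X' × ι => (χX' k) p.1) ∘ₗ (fgrad η'⁻¹ (liftEquiv (τ' μ) ι) ∘ₗ (N' k))) (mulOp (fun p : X × ι => (χX k) p.1) ∘ₗ (fgrad η⁻¹ (liftEquiv (τ μ) ι) ∘ₗ (N k))))
      (fun y y' => ind (Sk k) y * ind (Sk k) y' * (m₁ * Real.exp (-(δ * g.dist y y')))))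
    (hDcutB : ∀ k, ∀ μ, HasMaj (BlockNorm.ofBlocks g (liftBlk blk ι)) (BlockNorm.ofBlocks g (liftBlk blk ι ∘ liftMap π ι))
      (idef (pull (liftMap π ι)) (pull (liftMap π ι)) (mulOp (fun p : X' × ι => (χX' k) p.1) ∘ₗ (bgrad η'⁻¹ (liftEquiv (τ' μ) ι) ∘ₗ (N' k))) (mulOp (fun p : X × ι => (χX k) p.1) ∘ₗ (bgrad η⁻¹ (liftEquiv (τ μ) ι) ∘ₗ (N k))))
      (fun y y' => ind (Sk k) y * ind (Sk k) y' * (m₁ * Real.exp (-(δ * g.dist y y')))))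
    -- the jet pieces' reversed insertions (output cut-offs), both grids
    (hs2 : ∀ k, ∀ μ, mulOp (fun p : X × ι => (χX k) p.1) ∘ₗ mulOp ((fun p : X × ι => (χtX k) p.1) ∘ (liftEquiv (τ μ) ι)) = mulOp ((fun p : X × ι => (χtX k) p.1) ∘ (liftEquiv (τ μ) ι)))
    (hsb2 : ∀ k, ∀ μ, mulOp (fun p : X × ι => (χX k) p.1) ∘ₗ mulOp ((fun p : X × ι => (χtX k) p.1) ∘ (liftEquiv (τ μ) ι).symm) = mulOp ((fun p : X × ι => (χtX k) p.1) ∘ (liftEquiv (τ μ) ι).symm))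
    (hdd2 : ∀ k, ∀ μ, mulOp (fun p : X × ι => (χX k) p.1) ∘ₗ mulOp (fgrad η⁻¹ (liftEquiv (τ μ) ι) (fun p : X × ι => (χtX k) p.1)) = mulOp (fgrad η⁻¹ (liftEquiv (τ μ) ι) (fun p : X × ι => (χtX k) p.1)))
    (hddb2 : ∀ k, ∀ μ, mulOp (fun p : X × ι => (χX k) p.1) ∘ₗ mulOp (bgrad η⁻¹ (liftEquiv (τ μ) ι) (fun p : X × ι => (χtX k) p.1)) = mulOp (bgrad η⁻¹ (liftEquiv (τ μ) ι) (fun p : X × ι => (χtX k) p.1)))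
    (hs2' : ∀ k, ∀ μ, mulOp (fun p' : X' × ι => (χX' k) p'.1) ∘ₗ mulOp ((fun p' : X' × ι => (χtX' k) p'.1) ∘ (liftEquiv (τ' μ) ι)) = mulOp ((fun p' : X' × ι => (χtX' k) p'.1) ∘ (liftEquiv (τ' μ) ι)))
    (hsb2' : ∀ k, ∀ μ, mulOp (fun p' : X' × ι => (χX' k) p'.1) ∘ₗ mulOp ((fun p' : X' × ι => (χtX' k) p'.1) ∘ (liftEquiv (τ' μ) ι).symm) =
      mulOp ((fun p' : X' × ι => (χtX' k) p'.1) ∘ (liftEquiv (τ' μ) ι).symm))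
    (hdd2' : ∀ k, ∀ μ, mulOp (fun p' : X' × ι => (χX' k) p'.1) ∘ₗ mulOp (fgrad η'⁻¹ (liftEquiv (τ' μ) ι) (fun p' : X' × ι => (χtX' k) p'.1)) = mulOp (fgrad η'⁻¹ (liftEquiv (τ' μ) ι) (fun p' : X' × ι => (χtX' k) p'.1)))
    (hddb2' : ∀ k, ∀ μ, mulOp (fun p' : X' × ι => (χX' k) p'.1) ∘ₗ mulOp (bgrad η'⁻¹ (liftEquiv (τ' μ) ι) (fun p' : X' × ι => (χtX' k) p'.1)) = mulOp (bgrad η'⁻¹ (liftEquiv (τ' μ) ι) (fun p' : X' × ι => (χtX' k) p'.1)))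
    (hq : (β + (β₁ + ct * β)) * (R * cr) * cr < 1)
    (hh1 : ∀ k, ∀ μ p, |fgrad η⁻¹ (liftEquiv (τ μ) ι) (fun p : X × ι => hX k p.1) p| ≤ c₁) (hh1b : ∀ k, ∀ μ p, |bgrad η⁻¹ (liftEquiv (τ μ) ι) (fun p : X × ι => hX k p.1) p| ≤ c₁)
    (hh1' : ∀ k, ∀ μ p', |fgrad η'⁻¹ (liftEquiv (τ' μ) ι) (fun p : X' × ι => hX' k p.1) p'| ≤ c₁) (hh1b' : ∀ k, ∀ μ p', |bgrad η'⁻¹ (liftEquiv (τ' μ) ι) (fun p : X' × ι => hX' k p.1) p'| ≤ c₁)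
    (hh2' : ∀ k, ∀ μ p', |fgradAdj η'⁻¹ (liftEquiv (τ' μ) ι) (fgrad η'⁻¹ (liftEquiv (τ' μ) ι) (fun p : X' × ι => hX' k p.1)) p'| ≤ c₂)
    (hf1 : ∀ k, ∀ μ p', |fgrad η'⁻¹ (liftEquiv (τ' μ) ι) (fun p : X' × ι => hX' k p.1) p' - fgrad η⁻¹ (liftEquiv (τ μ) ι) (fun p : X × ι => hX k p.1) (liftMap π ι p')| ≤ o₁)
    (hf1b : ∀ k, ∀ μ p', |bgrad η'⁻¹ (liftEquiv (τ' μ) ι) (fun p : X' × ι => hX' k p.1) p' - bgrad η⁻¹ (liftEquiv (τ μ) ι) (fun p : X × ι => hX k p.1) (liftMap π ι p')| ≤ o₁)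
    (hf2 : ∀ k, ∀ μ p', |fgradAdj η'⁻¹ (liftEquiv (τ' μ) ι) (fgrad η'⁻¹ (liftEquiv (τ' μ) ι) (fun p : X' × ι => hX' k p.1)) p' - fgradAdj η⁻¹ (liftEquiv (τ μ) ι) (fgrad η⁻¹ (liftEquiv (τ μ) ι) (fun p : X × ι => hX k p.1)) (liftMap π ι p')| ≤ o₂)
    (hLip : ∀ k, ∀ y y', |(hb k) y - (hb k) y'| ≤ ℓ * g.dist y y') (hrh : ∀ k (p : X × ι), |hX k p.1 - (hb k) (liftBlk blk ι p)| ≤ ω) (hrh' : ∀ k (p' : X' × ι), |hX' k p'.1 - (hb k) (liftBlk (blk ∘ π) ι p')| ≤ ω)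
    (hfh : ∀ k (p' : X' × ι), |hX' k p'.1 - hX k (π p'.1)| ≤ oo) (hstep : ∀ μ x, g.dist (blk (τ μ x)) (blk x) ≤ d₁) (hstep' : ∀ μ x', g.dist (blk (π (τ' μ x'))) (blk (π x')) ≤ d₁)
    (hKN' : ∀ k, HasMaj (BlockNorm.ofBlocks g (liftBlk (blk ∘ π) ι)) (BlockNorm.ofBlocks g (liftBlk (blk ∘ π) ι)) (commOp NL' (fun p : X' × ι => hX' k p.1)) (fun y y' => cN * Real.exp (-(ρN * g.dist y y'))))
    (hDKN : ∀ k, HasMaj (BlockNorm.ofBlocks g (liftBlk blk ι)) (BlockNorm.ofBlocks g (liftBlk (blk ∘ π) ι))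
      (idef (pull (liftMap π ι)) (pull (liftMap π ι)) (commOp NL' (fun p : X' × ι => hX' k p.1)) (commOp NL (fun p : X × ι => hX k p.1))) (fun y y' => rN * Real.exp (-(ρN * g.dist y y'))))

    -- per cube, beyond file 39's data: the coarse second differences, the one-grid `W`-rows at both grids, the coarse `[N_L, M_h]` letter, the partition's sizes and cut support, the tail rows and their defect
    (hh2 : ∀ k, ∀ μ p, |fgradAdj η⁻¹ (liftEquiv (τ μ) ι) (fgrad η⁻¹ (liftEquiv (τ μ) ι) (fun p : X × ι => hX k p.1)) p| ≤ c₂)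
    (hKN : ∀ k, HasMaj (BlockNorm.ofBlocks g (liftBlk blk ι)) (BlockNorm.ofBlocks g (liftBlk blk ι)) (commOp NL (fun p : X × ι => hX k p.1)) (fun y y' => cN * Real.exp (-(ρN * g.dist y y'))))
    (hhabs : ∀ k x, |hX k x| ≤ 1) (hhabs' : ∀ k x', |hX' k x'| ≤ 1)
    (hhcut : ∀ k, mulOp (fun p : X × ι => hX k p.1) ∘ₗ mulOp (fun p : X × ι => χX k p.1) = mulOp (fun p : X × ι => hX k p.1)) (hhcut' : ∀ k, mulOp (fun p : X' × ι => hX' k p.1) ∘ₗ mulOp (fun p : X' × ι => χX' k p.1) = mulOp (fun p : X' × ι => hX' k p.1))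
    (hN : ∀ b, ∑ k, ind (Sk k) b ≤ Nov)
    (hT : ∀ k, HasMaj (BlockNorm.ofBlocks g (liftBlk blk ι)) (BlockNorm.ofBlocks g (liftBlk blk ι)) ((-(mulOp (fun p : X × ι => hX k p.1) ∘ₗ NL ∘ₗ mulOp (1 - fun p : X × ι => χtX k p.1))) ∘ₗ N k) (fun y y' => ind (Sk k) y * ind (Sk k) y' * (ε₀ * Real.exp (-(ρT * g.dist y y')))))
    (hT' : ∀ k, HasMaj (BlockNorm.ofBlocks g (liftBlk (blk ∘ π) ι)) (BlockNorm.ofBlocks g (liftBlk (blk ∘ π) ι)) ((-(mulOp (fun p : X' × ι => hX' k p.1) ∘ₗ NL' ∘ₗ mulOp (1 - fun p : X' × ι => χtX' k p.1))) ∘ₗ N' k) (fun y y' => ind (Sk k) y * ind (Sk k) y' * (ε₀ * Real.exp (-(ρT * g.dist y y')))))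
    (hDT : ∀ k, HasMaj (BlockNorm.ofBlocks g (liftBlk blk ι)) (BlockNorm.ofBlocks g (liftBlk (blk ∘ π) ι)) (idef (pull (liftMap π ι)) (pull (liftMap π ι)) ((-(mulOp (fun p : X' × ι => hX' k p.1) ∘ₗ NL' ∘ₗ mulOp (1 - fun p : X' × ι => χtX' k p.1))) ∘ₗ N' k) ((-(mulOp (fun p : X × ι => hX k p.1) ∘ₗ NL ∘ₗ mulOp (1 - fun p : X × ι => χtX k p.1))) ∘ₗ N k)) (fun y y' => ind (Sk k) y * ind (Sk k) y' * (rF * Real.exp (-(ρT * g.dist y y')))))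
    (hfitW : ∀ k x' i, ∑ j, |coordMat e (ContinuousLinearMap.mulLeftRight ℝ (Matrix m m ℂ) (u' k x') (u' k x')ᴴ) i j - coordMat e (ContinuousLinearMap.mulLeftRight ℝ (Matrix m m ℂ) (u k (π x')) (u k (π x'))ᴴ) i j| ≤ oW)
    (hfitWT : ∀ k x' i, ∑ j, |(coordMat e (ContinuousLinearMap.mulLeftRight ℝ (Matrix m m ℂ) (u' k x') (u' k x')ᴴ))ᵀ i j - (coordMat e (ContinuousLinearMap.mulLeftRight ℝ (Matrix m m ℂ) (u k (π x')) (u k (π x'))ᴴ))ᵀ i j| ≤ oW) (hoW : 0 ≤ oW)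
    -- THE GAUGE GROUP OF RECORD ON BOTH GRIDS: trace-form coordinates `e` of `𝔤 = 𝔲(m)`, unitary per-cube site gauges `u_k` (coarse) ∕ `u′_k` (fine), unitary bond variables `U`, `U′`,
    -- Bałaban's nonlocal summands `P`, `P′` read in the cube's gauges as the flat `N_L`, `N′_L` minus per-cube nonlocal perturbations `N_V k`, `N′_V k`; the species of the transformed bond
    -- variables SMALL WHERE `χ_k ≠ 0` ∕ `χ′_k ≠ 0` ((3.35) on the cube) and FITTING across `π` on the cut; the letters, far letters and η-defects of `N_V k`, `N′_V k`
    (he : ∀ A B : Matrix m m ℂ, traceForm A B = e A ⬝ᵥ e B) (hu : ∀ k x, (u k x)ᴴ * u k x = 1) (hu' : ∀ k x', (u' k x')ᴴ * u' k x' = 1) {rV RN θF ρF rD oV oN : ℝ} (hrV : 0 ≤ rV)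
    (hRN : 0 ≤ RN) (hθF : 0 ≤ θF) (hρF : ρ₃ + σ ≤ ρF) (hrD : 0 ≤ rD) (hoV : 0 ≤ oV) (hoN : 0 ≤ oN) (hRle : rV * (1 + Fintype.card (J ⊕ J)) + RN ≤ R) (hole : oV * (1 + Fintype.card (J ⊕ J)) + oN ≤ o)
    (hP : ∀ k, mmulOp (fun x => coordMat e (ContinuousLinearMap.mulLeftRight ℝ (Matrix m m ℂ) (u k x) (u k x)ᴴ)) ∘ₗ P ∘ₗ mmulOp (fun x => (coordMat e (ContinuousLinearMap.mulLeftRight ℝ (Matrix m m ℂ) (u k x) (u k x)ᴴ))ᵀ) = NL - NV k)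
    (hP' : ∀ k, mmulOp (fun x' => coordMat e (ContinuousLinearMap.mulLeftRight ℝ (Matrix m m ℂ) (u' k x') (u' k x')ᴴ)) ∘ₗ P' ∘ₗ mmulOp (fun x' => (coordMat e (ContinuousLinearMap.mulLeftRight ℝ (Matrix m m ℂ) (u' k x') (u' k x')ᴴ))ᵀ) = NL' - NV' k)
    (hχ1 : ∀ k x, |χX k x| ≤ 1) (hχ1' : ∀ k x', |χX' k x'| ≤ 1) (hψχ : ∀ k, mulOp (fun p : X × ι => ψX k p.1) ∘ₗ mulOp (fun p : X × ι => χX k p.1) = mulOp (fun p : X × ι => χX k p.1))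
    (hψχ' : ∀ k, mulOp (fun p : X' × ι => ψX' k p.1) ∘ₗ mulOp (fun p : X' × ι => χX' k p.1) = mulOp (fun p : X' × ι => χX' k p.1))
    (hCloc : ∀ k x, χX k x ≠ 0 → ∀ i, ∑ j, |tCoefC η (gaugePair τ fun μ x => coordMat e (ContinuousLinearMap.mulLeftRight ℝ (Matrix m m ℂ) (u k x * U μ x * (u k (τ μ x))ᴴ) (u k x * U μ x * (u k (τ μ x))ᴴ)ᴴ)) x i j| ≤ rV)
    (hAloc : ∀ k j' x, χX k x ≠ 0 → ∀ i, ∑ j, |tCoefA η (gaugePair τ fun μ x => coordMat e (ContinuousLinearMap.mulLeftRight ℝ (Matrix m m ℂ) (u k x * U μ x * (u k (τ μ x))ᴴ) (u k x * U μ x * (u k (τ μ x))ᴴ)ᴴ)) j' x i j| ≤ rV)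
    (hCloc' : ∀ k x', χX' k x' ≠ 0 → ∀ i, ∑ j, |tCoefC η' (gaugePair τ' fun μ x' => coordMat e (ContinuousLinearMap.mulLeftRight ℝ (Matrix m m ℂ) (u' k x' * U' μ x' * (u' k (τ' μ x'))ᴴ) (u' k x' * U' μ x' * (u' k (τ' μ x'))ᴴ)ᴴ)) x' i j| ≤ rV)
    (hAloc' : ∀ k j' x', χX' k x' ≠ 0 → ∀ i, ∑ j, |tCoefA η' (gaugePair τ' fun μ x' => coordMat e (ContinuousLinearMap.mulLeftRight ℝ (Matrix m m ℂ) (u' k x' * U' μ x' * (u' k (τ' μ x'))ᴴ) (u' k x' * U' μ x' * (u' k (τ' μ x'))ᴴ)ᴴ)) j' x' i j| ≤ rV)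
    (hfitC : ∀ k x' i, ∑ j, |(χX' k x' • tCoefC η' (gaugePair τ' fun μ x' => coordMat e (ContinuousLinearMap.mulLeftRight ℝ (Matrix m m ℂ) (u' k x' * U' μ x' * (u' k (τ' μ x'))ᴴ) (u' k x' * U' μ x' * (u' k (τ' μ x'))ᴴ)ᴴ)) x') i j - (χX k (π x') • tCoefC η (gaugePair τ fun μ x => coordMat e (ContinuousLinearMap.mulLeftRight ℝ (Matrix m m ℂ) (u k x * U μ x * (u k (τ μ x))ᴴ) (u k x * U μ x * (u k (τ μ x))ᴴ)ᴴ)) (π x')) i j| ≤ oV)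
    (hfitA : ∀ k j' x' i, ∑ j, |(χX' k x' • tCoefA η' (gaugePair τ' fun μ x' => coordMat e (ContinuousLinearMap.mulLeftRight ℝ (Matrix m m ℂ) (u' k x' * U' μ x' * (u' k (τ' μ x'))ᴴ) (u' k x' * U' μ x' * (u' k (τ' μ x'))ᴴ)ᴴ)) j' x') i j - (χX k (π x') • tCoefA η (gaugePair τ fun μ x => coordMat e (ContinuousLinearMap.mulLeftRight ℝ (Matrix m m ℂ) (u k x * U μ x * (u k (τ μ x))ᴴ) (u k x * U μ x * (u k (τ μ x))ᴴ)ᴴ)) j' (π x')) i j| ≤ oV)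
    (hNVcut : ∀ k, HasMaj (BlockNorm.ofBlocks g (liftBlk blk ι)) (BlockNorm.ofBlocks g (liftBlk blk ι)) (mulOp (fun p : X × ι => ψX k p.1) ∘ₗ NV k ∘ₗ mulOp (fun p : X × ι => χX k p.1)) (fun y y' => RN * Real.exp (-(δV * g.dist y y'))))
    (hNVcut' : ∀ k, HasMaj (BlockNorm.ofBlocks g (liftBlk (blk ∘ π) ι)) (BlockNorm.ofBlocks g (liftBlk (blk ∘ π) ι)) (mulOp (fun p : X' × ι => ψX' k p.1) ∘ₗ NV' k ∘ₗ mulOp (fun p : X' × ι => χX' k p.1)) (fun y y' => RN * Real.exp (-(δV * g.dist y y'))))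
    (hDNV : ∀ k, HasMaj (BlockNorm.ofBlocks g (liftBlk blk ι)) (BlockNorm.ofBlocks g (liftBlk (blk ∘ π) ι))
      (idef (pull (liftMap π ι)) (pull (liftMap π ι)) (mulOp (fun p : X' × ι => ψX' k p.1) ∘ₗ NV' k ∘ₗ mulOp (fun p : X' × ι => χX' k p.1)) (mulOp (fun p : X × ι => ψX k p.1) ∘ₗ NV k ∘ₗ mulOp (fun p : X × ι => χX k p.1))) (fun y y' => oN * Real.exp (-(δV * g.dist y y'))))
    (hfarN : ∀ k, HasMaj (BlockNorm.ofBlocks g (liftBlk blk ι)) (BlockNorm.ofBlocks g (liftBlk blk ι)) ((LinearMap.id - mulOp (fun p : X × ι => ψX k p.1)) ∘ₗ NV k ∘ₗ mulOp (fun p : X × ι => χX k p.1)) (fun y y' => θF * Real.exp (-(ρF * g.dist y y'))))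
    (hfarN' : ∀ k, HasMaj (BlockNorm.ofBlocks g (liftBlk (blk ∘ π) ι)) (BlockNorm.ofBlocks g (liftBlk (blk ∘ π) ι)) ((LinearMap.id - mulOp (fun p : X' × ι => ψX' k p.1)) ∘ₗ NV' k ∘ₗ mulOp (fun p : X' × ι => χX' k p.1)) (fun y y' => θF * Real.exp (-(ρF * g.dist y y'))))
    (hDfarN : ∀ k, HasMaj (BlockNorm.ofBlocks g (liftBlk blk ι)) (BlockNorm.ofBlocks g (liftBlk (blk ∘ π) ι)) (idef (pull (liftMap π ι)) (pull (liftMap π ι)) ((LinearMap.id - mulOp (fun p : X' × ι => ψX' k p.1)) ∘ₗ NV' k ∘ₗ mulOp (fun p : X' × ι => χX' k p.1))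
      ((LinearMap.id - mulOp (fun p : X × ι => ψX k p.1)) ∘ₗ NV k ∘ₗ mulOp (fun p : X × ι => χX k p.1))) (fun y y' => rD * Real.exp (-(ρF * g.dist y y'))))
    -- supports of the partitions inside `ψ_k`, `χ_k` ∕ `ψ′_k`, `χ′_k` (with shifts and differences), both grids
    (hhψ : ∀ k, mulOp (fun p : X × ι => hX k p.1) ∘ₗ mulOp (fun p : X × ι => ψX k p.1) = mulOp (fun p : X × ι => hX k p.1)) (hχh : ∀ k, mulOp (fun p : X × ι => χX k p.1) ∘ₗ mulOp (fun p : X × ι => hX k p.1) = mulOp (fun p : X × ι => hX k p.1))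
    (hhs' : ∀ k μ, mulOp (fun p : X × ι => χX k p.1) ∘ₗ mulOp ((fun p : X × ι => hX k p.1) ∘ (liftEquiv (τ μ) ι)) = mulOp ((fun p : X × ι => hX k p.1) ∘ (liftEquiv (τ μ) ι)))
    (hhsb' : ∀ k μ, mulOp (fun p : X × ι => χX k p.1) ∘ₗ mulOp ((fun p : X × ι => hX k p.1) ∘ (liftEquiv (τ μ) ι).symm) = mulOp ((fun p : X × ι => hX k p.1) ∘ (liftEquiv (τ μ) ι).symm))
    (hhdd' : ∀ k μ, mulOp (fun p : X × ι => χX k p.1) ∘ₗ mulOp (fgrad η⁻¹ (liftEquiv (τ μ) ι) (fun p : X × ι => hX k p.1)) = mulOp (fgrad η⁻¹ (liftEquiv (τ μ) ι) (fun p : X × ι => hX k p.1)))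
    (hhddb' : ∀ k μ, mulOp (fun p : X × ι => χX k p.1) ∘ₗ mulOp (bgrad η⁻¹ (liftEquiv (τ μ) ι) (fun p : X × ι => hX k p.1)) = mulOp (bgrad η⁻¹ (liftEquiv (τ μ) ι) (fun p : X × ι => hX k p.1)))
    (hhψf : ∀ k, mulOp (fun p : X' × ι => hX' k p.1) ∘ₗ mulOp (fun p : X' × ι => ψX' k p.1) = mulOp (fun p : X' × ι => hX' k p.1)) (hχhf : ∀ k, mulOp (fun p : X' × ι => χX' k p.1) ∘ₗ mulOp (fun p : X' × ι => hX' k p.1) = mulOp (fun p : X' × ι => hX' k p.1))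
    (hhsf : ∀ k μ, mulOp (fun p : X' × ι => χX' k p.1) ∘ₗ mulOp ((fun p : X' × ι => hX' k p.1) ∘ (liftEquiv (τ' μ) ι)) = mulOp ((fun p : X' × ι => hX' k p.1) ∘ (liftEquiv (τ' μ) ι)))
    (hhsbf : ∀ k μ, mulOp (fun p : X' × ι => χX' k p.1) ∘ₗ mulOp ((fun p : X' × ι => hX' k p.1) ∘ (liftEquiv (τ' μ) ι).symm) = mulOp ((fun p : X' × ι => hX' k p.1) ∘ (liftEquiv (τ' μ) ι).symm))
    (hhddf : ∀ k μ, mulOp (fun p : X' × ι => χX' k p.1) ∘ₗ mulOp (fgrad η'⁻¹ (liftEquiv (τ' μ) ι) (fun p : X' × ι => hX' k p.1)) = mulOp (fgrad η'⁻¹ (liftEquiv (τ' μ) ι) (fun p : X' × ι => hX' k p.1)))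
    (hhddbf : ∀ k μ, mulOp (fun p : X' × ι => χX' k p.1) ∘ₗ mulOp (bgrad η'⁻¹ (liftEquiv (τ' μ) ι) (fun p : X' × ι => hX' k p.1)) = mulOp (bgrad η'⁻¹ (liftEquiv (τ' μ) ι) (fun p : X' × ι => hX' k p.1)))
    (hq' : Nov * ((Fintype.card ι : ℝ) ^ 2 * ((((Fintype.card J : ℝ) * (c₂ * ((β + (β₁ + ct * β)) * (1 - (β + (β₁ + ct * β)) * (R * cr) * cr)⁻¹) + 2 * (c₁ * ((β + (β₁ + ct * β)) * (1 - (β + (β₁ + ct * β)) * (R * cr) * cr)⁻¹))) + θW + cN * ((β + (β₁ + ct * β)) * (1 - (β + (β₁ + ct * β)) * (R * cr) * cr)⁻¹) * cr)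
          + ((ℓ * (Real.exp 1 * ε)⁻¹ + 2 * (ω + ℓ * d₁)) * R * ((β + (β₁ + ct * β)) * (1 - (β + (β₁ + ct * β)) * (R * cr) * cr)⁻¹) * cr + R * c₁ * ((β + (β₁ + ct * β)) * (1 - (β + (β₁ + ct * β)) * (R * cr) * cr)⁻¹) * cr)) + (θF * (1 * ((β + (β₁ + ct * β)) * (1 - (β + (β₁ + ct * β)) * (R * cr) * cr)⁻¹)) * cr)) + (Fintype.card ι : ℝ) ^ 2 * ((ε₀ * (1 - (β + (β₁ + ct * β)) * (R * cr) * cr)⁻¹) + 0)) * cr < 1) :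
    HasMaj (BlockNorm.ofBlocks g (liftBlk blk ι)) (BlockNorm.ofBlocks g (liftBlk (blk ∘ π) ι))
      (idef (pull (liftMap π ι)) (pull (liftMap π ι))
        (glueInv (parametrix (fun k (p : X' × ι) => hX' k p.1) (fun k => mmulOp (fun x' => (coordMat e (ContinuousLinearMap.mulLeftRight ℝ (Matrix m m ℂ) (u' k x') (u' k x')ᴴ))ᵀ) ∘ₗ (projO none ∘ₗ bgPropV (stack (mulOp (fun p : X' × ι => χtX' k p.1) ∘ₗ N' k) (fun j => Sum.elim (fun μ => fgrad η'⁻¹ (liftEquiv (τ' μ) ι)) (fun μ => bgrad η'⁻¹ (liftEquiv (τ' μ) ι)) j ∘ₗ (mulOp (fun p : X' × ι => χtX' k p.1) ∘ₗ N' k))) (mulOp (fun p : X' × ι => ψX' k p.1) ∘ₗ (unstackM (tCoefC η' (gaugePair τ' fun μ x' => coordMat e (ContinuousLinearMap.mulLeftRight ℝ (Matrix m m ℂ) (u' k x' * U' μ x' * (u' k (τ' μ x'))ᴴ) (u' k x' * U' μ x' * (u' k (τ' μ x'))ᴴ)ᴴ)))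
            (tCoefA η' (gaugePair τ' fun μ x' => coordMat e (ContinuousLinearMap.mulLeftRight ℝ (Matrix m m ℂ) (u' k x' * U' μ x' * (u' k (τ' μ x'))ᴴ) (u' k x' * U' μ x' * (u' k (τ' μ x'))ᴴ)ᴴ))) + NV' k ∘ₗ projO none) ∘ₗ mulOp (fun q : (X' × ι) × Option (J ⊕ J) => χX' k q.1.1))) ∘ₗ mmulOp (fun x' => coordMat e (ContinuousLinearMap.mulLeftRight ℝ (Matrix m m ℂ) (u' k x') (u' k x')ᴴ))))
          (remainder (covLapM τ' η' (gaugePair τ' (fun μ x' => coordMat e (ContinuousLinearMap.mulLeftRight ℝ (Matrix m m ℂ) (U' μ x') (U' μ x')ᴴ))) + P') (fun k (p : X' × ι) => hX' k p.1) (fun k => mmulOp (fun x' => (coordMat e (ContinuousLinearMap.mulLeftRight ℝ (Matrix m m ℂ) (u' k x') (u' k x')ᴴ))ᵀ) ∘ₗ (projO none ∘ₗ bgPropV (stack (mulOp (fun p : X' × ι => χtX' k p.1) ∘ₗ N' k) (fun j => Sum.elim (fun μ => fgrad η'⁻¹ (liftEquiv (τ' μ) ι)) (fun μ => bgrad η'⁻¹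 (liftEquiv (τ' μ) ι)) j ∘ₗ (mulOp (fun p : X' × ι => χtX' k p.1) ∘ₗ N' k))) (mulOp (fun p : X' × ι => ψX' k p.1) ∘ₗ (unstackM (tCoefC η' (gaugePair τ' fun μ x' => coordMat e (ContinuousLinearMap.mulLeftRight ℝ (Matrix m m ℂ) (u' k x' * U' μ x' * (u' k (τ' μ x'))ᴴ) (u' k x' * U' μ x' * (u' k (τ' μ x'))ᴴ)ᴴ)))
            (tCoefA η' (gaugePair τ' fun μ x' => coordMat e (ContinuousLinearMap.mulLeftRight ℝ (Matrix m m ℂ) (u' k x' * U' μ x' * (u' k (τ' μ x'))ᴴ) (u' k x' * U' μ x' * (u' k (τ' μ x'))ᴴ)ᴴ))) + NV' k ∘ₗ projO none) ∘ₗ mulOp (fun q : (X' × ι) × Option (J ⊕ J) => χX' k q.1.1))) ∘ₗ mmulOp (fun x' => coordMat e (ContinuousLinearMap.mulLeftRight ℝ (Matrix m m ℂ) (u' k x') (u' k x')ᴴ))) -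
            ∑ k, (mmulOp (fun x' => (coordMat e (ContinuousLinearMap.mulLeftRight ℝ (Matrix m m ℂ) (u' k x') (u' k x')ᴴ))ᵀ) ∘ₗ ((((-(mulOp (fun p : X' × ι => hX' k p.1) ∘ₗ NL' ∘ₗ mulOp (1 - fun p : X' × ι => χtX' k p.1))) ∘ₗ N' k) ∘ₗ (LinearMap.id + ((mulOp (fun p : X' × ι => ψX' k p.1) ∘ₗ (unstackM (tCoefC η' (gaugePair τ' fun μ x' => coordMat e (ContinuousLinearMap.mulLeftRight ℝ (Matrix m m ℂ) (u' k x' * U' μ x' * (u' k (τ' μ x'))ᴴ) (u' k x' * U' μ x' * (u' k (τ' μ x'))ᴴ)ᴴ)))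
            (tCoefA η' (gaugePair τ' fun μ x' => coordMat e (ContinuousLinearMap.mulLeftRight ℝ (Matrix m m ℂ) (u' k x' * U' μ x' * (u' k (τ' μ x'))ᴴ) (u' k x' * U' μ x' * (u' k (τ' μ x'))ᴴ)ᴴ))) + NV' k ∘ₗ projO none) ∘ₗ mulOp (fun q : (X' × ι) × Option (J ⊕ J) => χX' k q.1.1)) ∘ₗ stack LinearMap.id (fun j => Sum.elim (fun μ => fgrad η'⁻¹ (liftEquiv (τ' μ) ι)) (fun μ => bgrad η'⁻¹ (liftEquiv (τ' μ) ι)) j)) ∘ₗ (projO none ∘ₗ bgPropV (stack (mulOp (fun p : X' × ι => χtX' k p.1) ∘ₗ N' k) (fun j => Sum.elim (fun μ => fgrad η'⁻¹ (liftEquiv (τ' μ) ι)) (fun μ => bgrad η'⁻¹ (liftEquiv (τ' μ) ι)) j ∘ₗ (mulOp (fun p : X' × ι => χtX' k p.1) ∘ₗ N' k))) (mulOp (fun p : X' × ι => ψX' k p.1) ∘ₗ (unstackM (tCoefC η' (gaugePair τ' fun μ x' => coordMat e (ContinuousLinearMap.mulLeftRight ℝ (Matrix m m ℂ) (u' k x'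 * U' μ x' * (u' k (τ' μ x'))ᴴ) (u' k x' * U' μ x' * (u' k (τ' μ x'))ᴴ)ᴴ)))
            (tCoefA η' (gaugePair τ' fun μ x' => coordMat e (ContinuousLinearMap.mulLeftRight ℝ (Matrix m m ℂ) (u' k x' * U' μ x' * (u' k (τ' μ x'))ᴴ) (u' k x' * U' μ x' * (u' k (τ' μ x'))ᴴ)ᴴ))) + NV' k ∘ₗ projO none) ∘ₗ mulOp (fun q : (X' × ι) × Option (J ⊕ J) => χX' k q.1.1)))) + mulOp (fun p : X' × ι => hX' k p.1) ∘ₗ (-(((unstackM (tCoefC η' (gaugePair τ' fun μ x' => coordMat e (ContinuousLinearMap.mulLeftRight ℝ (Matrix m m ℂ) (u' k x' * U' μ x' * (u' k (τ' μ x'))ᴴ) (u' k x' * U' μ x' * (u' k (τ' μ x'))ᴴ)ᴴ)))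
            (tCoefA η' (gaugePair τ' fun μ x' => coordMat e (ContinuousLinearMap.mulLeftRight ℝ (Matrix m m ℂ) (u' k x' * U' μ x' * (u' k (τ' μ x'))ᴴ) (u' k x' * U' μ x' * (u' k (τ' μ x'))ᴴ)ᴴ))) + NV' k ∘ₗ projO none) - mulOp (fun p : X' × ι => ψX' k p.1) ∘ₗ (unstackM (tCoefC η' (gaugePair τ' fun μ x' => coordMat e (ContinuousLinearMap.mulLeftRight ℝ (Matrix m m ℂ) (u' k x' * U' μ x' * (u' k (τ' μ x'))ᴴ) (u' k x' * U' μ x' * (u' k (τ' μ x'))ᴴ)ᴴ)))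
            (tCoefA η' (gaugePair τ' fun μ x' => coordMat e (ContinuousLinearMap.mulLeftRight ℝ (Matrix m m ℂ) (u' k x' * U' μ x' * (u' k (τ' μ x'))ᴴ) (u' k x' * U' μ x' * (u' k (τ' μ x'))ᴴ)ᴴ))) + NV' k ∘ₗ projO none) ∘ₗ mulOp (fun q : (X' × ι) × Option (J ⊕ J) => χX' k q.1.1)) ∘ₗ stack LinearMap.id (fun j => Sum.elim (fun μ => fgrad η'⁻¹ (liftEquiv (τ' μ) ι)) (fun μ => bgrad η'⁻¹ (liftEquiv (τ' μ) ι)) j))) ∘ₗ (projO none ∘ₗ bgPropV (stack (mulOp (fun p : X' × ι => χtX' k p.1) ∘ₗ N' k) (fun j => Sum.elim (fun μ => fgrad η'⁻¹ (liftEquiv (τ' μ) ι)) (fun μ => bgrad η'⁻¹ (liftEquiv (τ' μ) ι)) j ∘ₗ (mulOp (fun p : X' × ι => χtX' k p.1) ∘ₗ N' k))) (mulOp (fun p : X' × ι => ψX' k p.1) ∘ₗ (unstackM (tCoefC η' (gaugePair τ' fun μ x' => coordMat e (ContinuousLinearMap.mulLeftRight ℝ (Matrix m m ℂ) (u' k x'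 * U' μ x' * (u' k (τ' μ x'))ᴴ) (u' k x' * U' μ x' * (u' k (τ' μ x'))ᴴ)ᴴ)))
            (tCoefA η' (gaugePair τ' fun μ x' => coordMat e (ContinuousLinearMap.mulLeftRight ℝ (Matrix m m ℂ) (u' k x' * U' μ x' * (u' k (τ' μ x'))ᴴ) (u' k x' * U' μ x' * (u' k (τ' μ x'))ᴴ)ᴴ))) + NV' k ∘ₗ projO none) ∘ₗ mulOp (fun q : (X' × ι) × Option (J ⊕ J) => χX' k q.1.1))))) ∘ₗ mmulOp (fun x' => coordMat e (ContinuousLinearMap.mulLeftRight ℝ (Matrix m m ℂ) (u' k x') (u' k x')ᴴ))) ∘ₗ mulOp (fun p : X' × ι => hX' k p.1)))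
        (glueInv (parametrix (fun k (p : X × ι) => hX k p.1) (fun k => mmulOp (fun x => (coordMat e (ContinuousLinearMap.mulLeftRight ℝ (Matrix m m ℂ) (u k x) (u k x)ᴴ))ᵀ) ∘ₗ (projO none ∘ₗ bgPropV (stack (mulOp (fun p : X × ι => χtX k p.1) ∘ₗ N k) (fun j => Sum.elim (fun μ => fgrad η⁻¹ (liftEquiv (τ μ) ι)) (fun μ => bgrad η⁻¹ (liftEquiv (τ μ) ι)) j ∘ₗ (mulOp (fun p : X × ι => χtX k p.1) ∘ₗ N k))) (mulOp (fun p : X × ι => ψX k p.1) ∘ₗ (unstackM (tCoefC η (gaugePair τ fun μ x => coordMat e (ContinuousLinearMap.mulLeftRight ℝ (Matrix m m ℂ) (u k x * U μ x * (u k (τ μ x))ᴴ) (u k x * U μ x * (u k (τ μ x))ᴴ)ᴴ)))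
            (tCoefA η (gaugePair τ fun μ x => coordMat e (ContinuousLinearMap.mulLeftRight ℝ (Matrix m m ℂ) (u k x * U μ x * (u k (τ μ x))ᴴ) (u k x * U μ x * (u k (τ μ x))ᴴ)ᴴ))) + NV k ∘ₗ projO none) ∘ₗ mulOp (fun q : (X × ι) × Option (J ⊕ J) => χX k q.1.1))) ∘ₗ mmulOp (fun x => coordMat e (ContinuousLinearMap.mulLeftRight ℝ (Matrix m m ℂ) (u k x) (u k x)ᴴ))))
          (remainder (covLapM τ η (gaugePair τ (fun μ x => coordMat e (ContinuousLinearMap.mulLeftRight ℝ (Matrix m m ℂ) (U μ x) (U μ x)ᴴ))) + P) (fun k (p : X × ι) => hX k p.1) (fun k => mmulOp (fun x => (coordMat e (ContinuousLinearMap.mulLeftRight ℝ (Matrix m m ℂ) (u k x) (u k x)ᴴ))ᵀ) ∘ₗ (projO none ∘ₗ bgPropV (stack (mulOp (fun p : X × ι => χtX k p.1) ∘ₗ N k) (fun j => Sum.elim (fun μ => fgrad η⁻¹ (liftEquiv (τ μ) ι)) (fun μ => bgrad η⁻¹ (liftEquiv (τ μ) ι)) j ∘ₗ (mulOp (fun p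 : X × ι => χtX k p.1) ∘ₗ N k))) (mulOp (fun p : X × ι => ψX k p.1) ∘ₗ (unstackM (tCoefC η (gaugePair τ fun μ x => coordMat e (ContinuousLinearMap.mulLeftRight ℝ (Matrix m m ℂ) (u k x * U μ x * (u k (τ μ x))ᴴ) (u k x * U μ x * (u k (τ μ x))ᴴ)ᴴ)))
            (tCoefA η (gaugePair τ fun μ x => coordMat e (ContinuousLinearMap.mulLeftRight ℝ (Matrix m m ℂ) (u k x * U μ x * (u k (τ μ x))ᴴ) (u k x * U μ x * (u k (τ μ x))ᴴ)ᴴ))) + NV k ∘ₗ projO none) ∘ₗ mulOp (fun q : (X × ι) × Option (J ⊕ J) => χX k q.1.1))) ∘ₗ mmulOp (fun x => coordMat e (ContinuousLinearMap.mulLeftRight ℝ (Matrix m m ℂ) (u k x) (u k x)ᴴ))) -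
            ∑ k, (mmulOp (fun x => (coordMat e (ContinuousLinearMap.mulLeftRight ℝ (Matrix m m ℂ) (u k x) (u k x)ᴴ))ᵀ) ∘ₗ ((((-(mulOp (fun p : X × ι => hX k p.1) ∘ₗ NL ∘ₗ mulOp (1 - fun p : X × ι => χtX k p.1))) ∘ₗ N k) ∘ₗ (LinearMap.id + ((mulOp (fun p : X × ι => ψX k p.1) ∘ₗ (unstackM (tCoefC η (gaugePair τ fun μ x => coordMat e (ContinuousLinearMap.mulLeftRight ℝ (Matrix m m ℂ) (u k x * U μ x * (u k (τ μ x))ᴴ) (u k x * U μ x * (u k (τ μ x))ᴴ)ᴴ)))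
            (tCoefA η (gaugePair τ fun μ x => coordMat e (ContinuousLinearMap.mulLeftRight ℝ (Matrix m m ℂ) (u k x * U μ x * (u k (τ μ x))ᴴ) (u k x * U μ x * (u k (τ μ x))ᴴ)ᴴ))) + NV k ∘ₗ projO none) ∘ₗ mulOp (fun q : (X × ι) × Option (J ⊕ J) => χX k q.1.1)) ∘ₗ stack LinearMap.id (fun j => Sum.elim (fun μ => fgrad η⁻¹ (liftEquiv (τ μ) ι)) (fun μ => bgrad η⁻¹ (liftEquiv (τ μ) ι)) j)) ∘ₗ (projO none ∘ₗ bgPropV (stack (mulOp (fun p : X × ι => χtX k p.1) ∘ₗ N k) (fun j => Sum.elim (fun μ => fgrad η⁻¹ (liftEquiv (τ μ) ι)) (fun μ => bgrad η⁻¹ (liftEquiv (τ μ) ι)) j ∘ₗ (mulOp (fun p : X × ι => χtX k p.1) ∘ₗ N k))) (mulOp (fun p : X × ι => ψX k p.1) ∘ₗ (unstackM (tCoefC η (gaugePair τ fun μ x => coordMat e (ContinuousLinearMap.mulLeftRight ℝ (Matrix m m ℂ) (u k x * U μ x * (u k (τ μ x))ᴴ) (u k x * U μ x * (u k (τ μ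 x))ᴴ)ᴴ)))
            (tCoefA η (gaugePair τ fun μ x => coordMat e (ContinuousLinearMap.mulLeftRight ℝ (Matrix m m ℂ) (u k x * U μ x * (u k (τ μ x))ᴴ) (u k x * U μ x * (u k (τ μ x))ᴴ)ᴴ))) + NV k ∘ₗ projO none) ∘ₗ mulOp (fun q : (X × ι) × Option (J ⊕ J) => χX k q.1.1)))) + mulOp (fun p : X × ι => hX k p.1) ∘ₗ (-(((unstackM (tCoefC η (gaugePair τ fun μ x => coordMat e (ContinuousLinearMap.mulLeftRight ℝ (Matrix m m ℂ) (u k x * U μ x * (u k (τ μ x))ᴴ) (u k x * U μ x * (u k (τ μ x))ᴴ)ᴴ)))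
            (tCoefA η (gaugePair τ fun μ x => coordMat e (ContinuousLinearMap.mulLeftRight ℝ (Matrix m m ℂ) (u k x * U μ x * (u k (τ μ x))ᴴ) (u k x * U μ x * (u k (τ μ x))ᴴ)ᴴ))) + NV k ∘ₗ projO none) - mulOp (fun p : X × ι => ψX k p.1) ∘ₗ (unstackM (tCoefC η (gaugePair τ fun μ x => coordMat e (ContinuousLinearMap.mulLeftRight ℝ (Matrix m m ℂ) (u k x * U μ x * (u k (τ μ x))ᴴ) (u k x * U μ x * (u k (τ μ x))ᴴ)ᴴ)))
            (tCoefA η (gaugePair τ fun μ x => coordMat e (ContinuousLinearMap.mulLeftRight ℝ (Matrix m m ℂ) (u k x * U μ x * (u k (τ μ x))ᴴ) (u k x * U μ x * (u k (τ μ x))ᴴ)ᴴ))) + NV k ∘ₗ projO none) ∘ₗ mulOp (fun q : (X × ι) × Option (J ⊕ J) => χX k q.1.1)) ∘ₗ stack LinearMap.id (fun j => Sum.elim (fun μ => fgrad η⁻¹ (liftEquiv (τ μ) ι)) (fun μ => bgrad η⁻¹ (liftEquiv (τ μ) ι)) j))) ∘ₗ (projO none ∘ₗ bgPropV (stack (mulOp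 (fun p : X × ι => χtX k p.1) ∘ₗ N k) (fun j => Sum.elim (fun μ => fgrad η⁻¹ (liftEquiv (τ μ) ι)) (fun μ => bgrad η⁻¹ (liftEquiv (τ μ) ι)) j ∘ₗ (mulOp (fun p : X × ι => χtX k p.1) ∘ₗ N k))) (mulOp (fun p : X × ι => ψX k p.1) ∘ₗ (unstackM (tCoefC η (gaugePair τ fun μ x => coordMat e (ContinuousLinearMap.mulLeftRight ℝ (Matrix m m ℂ) (u k x * U μ x * (u k (τ μ x))ᴴ) (u k x * U μ x * (u k (τ μ x))ᴴ)ᴴ)))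
            (tCoefA η (gaugePair τ fun μ x => coordMat e (ContinuousLinearMap.mulLeftRight ℝ (Matrix m m ℂ) (u k x * U μ x * (u k (τ μ x))ᴴ) (u k x * U μ x * (u k (τ μ x))ᴴ)ᴴ))) + NV k ∘ₗ projO none) ∘ₗ mulOp (fun q : (X × ι) × Option (J ⊕ J) => χX k q.1.1))))) ∘ₗ mmulOp (fun x => coordMat e (ContinuousLinearMap.mulLeftRight ℝ (Matrix m m ℂ) (u k x) (u k x)ᴴ))) ∘ₗ mulOp (fun p : X × ι => hX k p.1))))
      (fun y y' => (Nov * ((Fintype.card ι : ℝ) ^ 2 * ((β + (β₁ + ct * β)) * (1 - (β + (β₁ + ct * β)) * (R * cr) * cr)⁻¹)) * ((1 - Nov * ((Fintype.card ι : ℝ) ^ 2 * ((((Fintype.card J : ℝ) * (c₂ * ((β + (β₁ + ct * β)) * (1 - (β + (β₁ + ct * β)) * (R * cr) * cr)⁻¹) + 2 * (c₁ * ((β + (β₁ + ct * β)) * (1 - (β + (β₁ + ct * β)) * (R * cr) * cr)⁻¹))) + θW + cN * ((β + (β₁ + ct * β)) * (1 - (β + (β₁ + ct * β)) * (R * cr)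 * cr)⁻¹) * cr)
          + ((ℓ * (Real.exp 1 * ε)⁻¹ + 2 * (ω + ℓ * d₁)) * R * ((β + (β₁ + ct * β)) * (1 - (β + (β₁ + ct * β)) * (R * cr) * cr)⁻¹) * cr + R * c₁ * ((β + (β₁ + ct * β)) * (1 - (β + (β₁ + ct * β)) * (R * cr) * cr)⁻¹) * cr)) + (θF * (1 * ((β + (β₁ + ct * β)) * (1 - (β + (β₁ + ct * β)) * (R * cr) * cr)⁻¹)) * cr)) + (Fintype.card ι : ℝ) ^ 2 * ((ε₀ * (1 - (β + (β₁ + ct * β)) * (R * cr) * cr)⁻¹) + 0)) * cr)⁻¹ *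
          ((1 - Nov * ((Fintype.card ι : ℝ) ^ 2 * ((((Fintype.card J : ℝ) * (c₂ * ((β + (β₁ + ct * β)) * (1 - (β + (β₁ + ct * β)) * (R * cr) * cr)⁻¹) + 2 * (c₁ * ((β + (β₁ + ct * β)) * (1 - (β + (β₁ + ct * β)) * (R * cr) * cr)⁻¹))) + θW + cN * ((β + (β₁ + ct * β)) * (1 - (β + (β₁ + ct * β)) * (R * cr) * cr)⁻¹) * cr)
          + ((ℓ * (Real.exp 1 * ε)⁻¹ + 2 * (ω + ℓ * d₁)) * R * ((β + (β₁ + ct * β)) * (1 - (β + (β₁ + ct * β)) * (R * cr) * cr)⁻¹) * cr + R * c₁ * ((β + (β₁ + ct * β)) * (1 - (β + (β₁ + ct * β)) * (R * cr) * cr)⁻¹) * cr)) + (θF * (1 * ((β + (β₁ + ct * β)) * (1 - (β + (β₁ + ct * β)) * (R * cr) * cr)⁻¹)) * cr)) + (Fintype.card ι : ℝ) ^ 2 * ((ε₀ * (1 - (β + (β₁ + ct * β)) * (R * cr) * cr)⁻¹) + 0)) * cr)⁻¹ *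
            (Nov * ((Fintype.card ι : ℝ) ^ 2 * ((((Fintype.card J : ℝ) * (c₂ * ((β + (β₁ + ct * β)) * (1 - (β + (β₁ + ct * β)) * (R * cr) * cr)⁻¹) + 2 * (c₁ * ((β + (β₁ + ct * β)) * (1 - (β + (β₁ + ct * β)) * (R * cr) * cr)⁻¹))) + θW + cN * ((β + (β₁ + ct * β)) * (1 - (β + (β₁ + ct * β)) * (R * cr) * cr)⁻¹) * cr)
          + ((ℓ * (Real.exp 1 * ε)⁻¹ + 2 * (ω + ℓ * d₁)) * R * ((β + (β₁ + ct * β)) * (1 - (β + (β₁ + ct * β)) * (R * cr) * cr)⁻¹) * cr + R * c₁ * ((β + (β₁ + ct * β)) * (1 - (β + (β₁ + ct * β)) * (R * cr) * cr)⁻¹) * cr)) + (θF * (1 * ((β + (β₁ + ct * β)) * (1 - (β + (β₁ + ct * β)) * (R * cr) * cr)⁻¹)) * cr)) * oo + ((Fintype.card ι : ℝ) ^ 2 * ((((Fintype.card J * (c₂ * ((((m₀ + oχ * β) + (m₁ + oχ₁ * β₁ + ct * m₀ + oχ₂ * β)) * cr + 1 * (((m₀ + oχ * β) + (m₁ + oχ₁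 * β₁ + ct * m₀ + oχ₂ * β)) * cr) * (R * ((β + (β₁ + ct * β)) * (1 - (β + (β₁ + ct * β)) * (R * cr) * cr)⁻¹) * cr) + (β + (β₁ + ct * β)) * o * cr * ((β + (β₁ + ct * β)) * (1 - (β + (β₁ + ct * β)) * (R * cr) * cr)⁻¹) * cr) * (1 - 1 * ((β + (β₁ + ct * β)) * (R * cr) * cr))⁻¹)
              + o₂ * ((β + (β₁ + ct * β)) * (1 - (β + (β₁ + ct * β)) * (R * cr) * cr)⁻¹)
              + 2 * (c₁ * ((((m₀ + oχ * β) + (m₁ + oχ₁ * β₁ + ct * m₀ + oχ₂ * β)) * cr + 1 * (((m₀ + oχ * β) + (m₁ + oχ₁ * β₁ + ct * m₀ + oχ₂ * β)) * cr) * (R * ((β + (β₁ + ct * β)) * (1 - (β + (β₁ + ct * β)) * (R * cr) * cr)⁻¹) * cr) + (β + (β₁ + ct * β)) * o * cr * ((β + (β₁ + ct * β)) * (1 - (β + (β₁ + ct * β)) * (R * cr) * cr)⁻¹) * cr) * (1 - 1 * ((β + (β₁ + ct * β)) * (R * cr) * cr))⁻¹)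
                + o₁ * ((β + (β₁ + ct * β)) * (1 - (β + (β₁ + ct * β)) * (R * cr) * cr)⁻¹))) + rW)
          + (cN * ((((m₀ + oχ * β) + (m₁ + oχ₁ * β₁ + ct * m₀ + oχ₂ * β)) * cr + 1 * (((m₀ + oχ * β) + (m₁ + oχ₁ * β₁ + ct * m₀ + oχ₂ * β)) * cr) * (R * ((β + (β₁ + ct * β)) * (1 - (β + (β₁ + ct * β)) * (R * cr) * cr)⁻¹) * cr) + (β + (β₁ + ct * β)) * o * cr * ((β + (β₁ + ct * β)) * (1 - (β + (β₁ + ct * β)) * (R * cr) * cr)⁻¹) * cr) * (1 - 1 * ((β + (β₁ + ct * β)) * (R * cr) * cr))⁻¹) * cr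
              + rN * ((β + (β₁ + ct * β)) * (1 - (β + (β₁ + ct * β)) * (R * cr) * cr)⁻¹) * cr)
          + ((((ℓ * (Real.exp 1 * ε)⁻¹ + 2 * (ω + ℓ * d₁)) * R)
                * ((((m₀ + oχ * β) + (m₁ + oχ₁ * β₁ + ct * m₀ + oχ₂ * β)) * cr + 1 * (((m₀ + oχ * β) + (m₁ + oχ₁ * β₁ + ct * m₀ + oχ₂ * β)) * cr) * (R * ((β + (β₁ + ct * β)) * (1 - (β + (β₁ + ct * β)) * (R * cr) * cr)⁻¹) * cr) + (β + (β₁ + ct * β)) * o * cr * ((β + (β₁ + ct * β)) * (1 - (β + (β₁ + ct * β)) * (R * cr) * cr)⁻¹) * cr) * (1 - 1 * ((β + (β₁ + ct * β)) * (R * cr) * cr))⁻¹)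
              + ((ℓ * (Real.exp 1 * ε)⁻¹ + 2 * (ω + ℓ * d₁)) * o + 2 * R * (oo + c₁ / η'⁻¹ + c₁ / η⁻¹))
                * ((β + (β₁ + ct * β)) * (1 - (β + (β₁ + ct * β)) * (R * cr) * cr)⁻¹)
              + R * (c₁ * ((((m₀ + oχ * β) + (m₁ + oχ₁ * β₁ + ct * m₀ + oχ₂ * β)) * cr + 1 * (((m₀ + oχ * β) + (m₁ + oχ₁ * β₁ + ct * m₀ + oχ₂ * β)) * cr) * (R * ((β + (β₁ + ct * β)) * (1 - (β + (β₁ + ct * β)) * (R * cr) * cr)⁻¹) * cr) + (β + (β₁ + ct * β)) * o * cr * ((β + (β₁ + ct * β)) * (1 - (β + (β₁ + ct * β)) * (R * cr) * cr)⁻¹) * cr) * (1 - 1 * ((β + (β₁ + ct * β)) * (R * cr) * cr))⁻¹)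
                + o₁ * ((β + (β₁ + ct * β)) * (1 - (β + (β₁ + ct * β)) * (R * cr) * cr)⁻¹))
              + o * c₁ * ((β + (β₁ + ct * β)) * (1 - (β + (β₁ + ct * β)) * (R * cr) * cr)⁻¹)) * cr))) + (θF * (1 * ((((m₀ + oχ * β) + (m₁ + oχ₁ * β₁ + ct * m₀ + oχ₂ * β)) * cr +
              1 * (((m₀ + oχ * β) + (m₁ + oχ₁ * β₁ + ct * m₀ + oχ₂ * β)) * cr) * (R * ((β + (β₁ + ct * β)) * (1 - (β + (β₁ + ct * β)) * (R * cr) * cr)⁻¹) * cr) +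
            (β + (β₁ + ct * β)) * o * cr * ((β + (β₁ + ct * β)) * (1 - (β + (β₁ + ct * β)) * (R * cr) * cr)⁻¹) * cr) *
          (1 - 1 * ((β + (β₁ + ct * β)) * (R * cr) * cr))⁻¹) + (1 * ((β + (β₁ + ct * β)) * (1 - (β + (β₁ + ct * β)) * (R * cr) * cr)⁻¹)) * oo) * cr + rD * (1 * ((β + (β₁ + ct * β)) * (1 - (β + (β₁ + ct * β)) * (R * cr) * cr)⁻¹)) * cr)) + 2 * (Fintype.card ι : ℝ) * oW * ((((Fintype.card J : ℝ) * (c₂ * ((β + (β₁ + ct * β)) * (1 - (β + (β₁ + ct * β)) * (R * cr) * cr)⁻¹) + 2 * (c₁ * ((β + (β₁ + ct * β)) * (1 - (β + (β₁ + ct * β)) * (R * cr) * cr)⁻¹))) + θW + cN * ((β + (β₁ + ct * β)) * (1 - (β + (β₁ + ct * β)) * (R * cr) * cr)⁻¹) * cr)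
          + ((ℓ * (Real.exp 1 * ε)⁻¹ + 2 * (ω + ℓ * d₁)) * R * ((β + (β₁ + ct * β)) * (1 - (β + (β₁ + ct * β)) * (R * cr) * cr)⁻¹) * cr + R * c₁ * ((β + (β₁ + ct * β)) * (1 - (β + (β₁ + ct * β)) * (R * cr) * cr)⁻¹) * cr)) + (θF * (1 * ((β + (β₁ + ct * β)) * (1 - (β + (β₁ + ct * β)) * (R * cr) * cr)⁻¹)) * cr))) +
              ((Fintype.card ι : ℝ) ^ 2 * ((ε₀ * (1 - (β + (β₁ + ct * β)) * (R * cr) * cr)⁻¹) + 0) * oo + ((Fintype.card ι : ℝ) ^ 2 * ((ε₀ * (R * ((((m₀ + oχ * β) + (m₁ + oχ₁ * β₁ + ct * m₀ + oχ₂ * β)) * cr + 1 * (((m₀ + oχ * β) + (m₁ + oχ₁ * β₁ + ct * m₀ + oχ₂ * β)) * cr) * (R * ((β + (β₁ + ct * β)) * (1 - (β + (β₁ + ct * β)) * (R * cr) * cr)⁻¹) * cr) + (β + (β₁ + ct * β)) * o * cr * ((β + (β₁ + ct * β)) * (1 - (β + (β₁ + ct * β)) * (R * cr) * cr)⁻¹)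 * cr) * (1 - 1 * ((β + (β₁ + ct * β)) * (R * cr) * cr))⁻¹) + o * ((β + (β₁ + ct * β)) * (1 - (β + (β₁ + ct * β)) * (R * cr) * cr)⁻¹)) * cr * cr + rF * (1 + R * ((β + (β₁ + ct * β)) * (1 - (β + (β₁ + ct * β)) * (R * cr) * cr)⁻¹) * cr * cr)) + 0) + 2 * (Fintype.card ι : ℝ) * oW * ((ε₀ * (1 - (β + (β₁ + ct * β)) * (R * cr) * cr)⁻¹) + 0))))) * cr) * cr) * cr +
        Nov * (2 * ((Fintype.card ι : ℝ) ^ 2 * ((β + (β₁ + ct * β)) * (1 - (β + (β₁ + ct * β)) * (R * cr) * cr)⁻¹)) * oo + ((Fintype.card ι : ℝ) ^ 2 * ((((m₀ + oχ * β) + (m₁ + oχ₁ * β₁ + ct * m₀ + oχ₂ * β)) * cr + 1 * (((m₀ + oχ * β) + (m₁ + oχ₁ * β₁ + ct * m₀ + oχ₂ * β)) * cr) * (R * ((β + (β₁ + ct * β)) * (1 - (β + (β₁ + ct * β)) * (R * cr) * cr)⁻¹) * cr) + (β + (β₁ + ct * β)) * o * cr * ((β + (β₁ + ct * β)) * (1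 - (β + (β₁ + ct * β)) * (R * cr) * cr)⁻¹) * cr) * (1 - 1 * ((β + (β₁ + ct * β)) * (R * cr) * cr))⁻¹) + 2 * (Fintype.card ι : ℝ) * oW * ((β + (β₁ + ct * β)) * (1 - (β + (β₁ + ct * β)) * (R * cr) * cr)⁻¹))) *
          (1 - Nov * ((Fintype.card ι : ℝ) ^ 2 * ((((Fintype.card J : ℝ) * (c₂ * ((β + (β₁ + ct * β)) * (1 - (β + (β₁ + ct * β)) * (R * cr) * cr)⁻¹) + 2 * (c₁ * ((β + (β₁ + ct * β)) * (1 - (β + (β₁ + ct * β)) * (R * cr) * cr)⁻¹))) + θW + cN * ((β + (β₁ + ct * β)) * (1 - (β + (β₁ + ct * β)) * (R * cr) * cr)⁻¹) * cr)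
          + ((ℓ * (Real.exp 1 * ε)⁻¹ + 2 * (ω + ℓ * d₁)) * R * ((β + (β₁ + ct * β)) * (1 - (β + (β₁ + ct * β)) * (R * cr) * cr)⁻¹) * cr + R * c₁ * ((β + (β₁ + ct * β)) * (1 - (β + (β₁ + ct * β)) * (R * cr) * cr)⁻¹) * cr)) + (θF * (1 * ((β + (β₁ + ct * β)) * (1 - (β + (β₁ + ct * β)) * (R * cr) * cr)⁻¹)) * cr)) + (Fintype.card ι : ℝ) ^ 2 * ((ε₀ * (1 - (β + (β₁ + ct * β)) * (R * cr) * cr)⁻¹) + 0)) * cr)⁻¹ * cr) *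
        Real.exp (-((ρ₃ - 2 * σ) * g.dist y y'))) := by
  have hβb : 0 ≤ β + (β₁ + ct * β) := by positivity
  have hqi : 0 ≤ (1 - (β + (β₁ + ct * β)) * (R * cr) * cr)⁻¹ := inv_nonneg.2 (by linarith)
  have hq1 : 0 ≤ (1 - 1 * ((β + (β₁ + ct * β)) * (R * cr) * cr))⁻¹ := by rw [one_mul]; exact hqi
  have hB : 0 ≤ ((β + (β₁ + ct * β)) * (1 - (β + (β₁ + ct * β)) * (R * cr) * cr)⁻¹) := mul_nonneg hβb hqi
  have hM : 0 ≤ (m₀ + oχ * β) + (m₁ + oχ₁ * β₁ + ct * m₀ + oχ₂ * β) :=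
    add_nonneg (add_nonneg hm₀ (mul_nonneg hoχ hβ)) (add_nonneg (add_nonneg (add_nonneg hm₁ (mul_nonneg hoχ₁ hβ₁)) (mul_nonneg hct hm₀)) (mul_nonneg hoχ₂ hβ))
  have hAD : 0 ≤ ((((m₀ + oχ * β) + (m₁ + oχ₁ * β₁ + ct * m₀ + oχ₂ * β)) * cr +
              1 * (((m₀ + oχ * β) + (m₁ + oχ₁ * β₁ + ct * m₀ + oχ₂ * β)) * cr) * (R * ((β + (β₁ + ct * β)) * (1 - (β + (β₁ + ct * β)) * (R * cr) * cr)⁻¹) * cr) +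
            (β + (β₁ + ct * β)) * o * cr * ((β + (β₁ + ct * β)) * (1 - (β + (β₁ + ct * β)) * (R * cr) * cr)⁻¹) * cr) *
          (1 - 1 * ((β + (β₁ + ct * β)) * (R * cr) * cr))⁻¹) :=
    mul_nonneg (add_nonneg (add_nonneg (mul_nonneg hM hcr) (mul_nonneg (mul_nonneg zero_le_one (mul_nonneg hM hcr)) (mul_nonneg (mul_nonneg hR hB) hcr)))
      (mul_nonneg (mul_nonneg (mul_nonneg (mul_nonneg hβb ho) hcr) hB) hcr)) hq1
  have hθF' : 0 ≤ (θF * (1 * ((β + (β₁ + ct * β)) * (1 - (β + (β₁ + ct * β)) * (R * cr) * cr)⁻¹)) * cr) := mul_nonneg (mul_nonneg hθF (mul_nonneg zero_le_one hB)) hcr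
  have hrFK' : 0 ≤ (θF * (1 * ((((m₀ + oχ * β) + (m₁ + oχ₁ * β₁ + ct * m₀ + oχ₂ * β)) * cr +
              1 * (((m₀ + oχ * β) + (m₁ + oχ₁ * β₁ + ct * m₀ + oχ₂ * β)) * cr) * (R * ((β + (β₁ + ct * β)) * (1 - (β + (β₁ + ct * β)) * (R * cr) * cr)⁻¹) * cr) +
            (β + (β₁ + ct * β)) * o * cr * ((β + (β₁ + ct * β)) * (1 - (β + (β₁ + ct * β)) * (R * cr) * cr)⁻¹) * cr) *
          (1 - 1 * ((β + (β₁ + ct * β)) * (R * cr) * cr))⁻¹) + (1 * ((β + (β₁ + ct * β)) * (1 - (β + (β₁ + ct * β)) * (R * cr) * cr)⁻¹)) * oo) * cr + rD * (1 * ((β + (β₁ + ct * β)) * (1 - (β + (β₁ + ct * β)) * (R * cr) * cr)⁻¹)) * cr) :=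
    add_nonneg (mul_nonneg (mul_nonneg hθF (add_nonneg (mul_nonneg zero_le_one hAD) (mul_nonneg (mul_nonneg zero_le_one hB) hoo))) hcr) (mul_nonneg (mul_nonneg hrD (mul_nonneg zero_le_one hB)) hcr)
  -- the gauges are orthogonal (dag-n15-w2 `uN_siteGauge_orthogonal`), both grids
  have hug : ∀ k x, coordMat e (ContinuousLinearMap.mulLeftRight ℝ (Matrix m m ℂ) (u k x) (u k x)ᴴ) * (coordMat e (ContinuousLinearMap.mulLeftRight ℝ (Matrix m m ℂ) (u k x) (u k x)ᴴ))ᵀ = 1 := fun k x => (uN_siteGauge_orthogonal e (u k) he (hu k) x).1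
  have hug' : ∀ k x, (coordMat e (ContinuousLinearMap.mulLeftRight ℝ (Matrix m m ℂ) (u k x) (u k x)ᴴ))ᵀ * coordMat e (ContinuousLinearMap.mulLeftRight ℝ (Matrix m m ℂ) (u k x) (u k x)ᴴ) = 1 := fun k x => (uN_siteGauge_orthogonal e (u k) he (hu k) x).2
  have hugf : ∀ k x', coordMat e (ContinuousLinearMap.mulLeftRight ℝ (Matrix m m ℂ) (u' k x') (u' k x')ᴴ) * (coordMat e (ContinuousLinearMap.mulLeftRight ℝ (Matrix m m ℂ) (u' k x') (u' k x')ᴴ))ᵀ = 1 := fun k x' => (uN_siteGauge_orthogonal e (u' k) he (hu' k) x').1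
  have hugf' : ∀ k x', (coordMat e (ContinuousLinearMap.mulLeftRight ℝ (Matrix m m ℂ) (u' k x') (u' k x')ᴴ))ᵀ * coordMat e (ContinuousLinearMap.mulLeftRight ℝ (Matrix m m ℂ) (u' k x') (u' k x')ᴴ) = 1 := fun k x' => (uN_siteGauge_orthogonal e (u' k) he (hu' k) x').2
  -- the covariance identities (`uN_localOp_eq_cut_add_farDefect` above), both grids
  have hcov := fun k => uN_localOp_eq_cut_add_farDefect τ e (u k) U (χX k) (ψX k) η he (hu k) (hP k)
  have hcov' := fun k => uN_localOp_eq_cut_add_farDefect τ' e (u' k) U' (χX' k) (ψX' k) η' he (hu' k) (hP' k)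
  -- the cube perturbations' letters and η-defect (file 51), both grids
  have hV : ∀ k, HasMaj (BlockNorm.ofBlocks g (blkPair (liftBlk blk ι))) (BlockNorm.ofBlocks g (liftBlk blk ι)) (mulOp (fun p : X × ι => ψX k p.1) ∘ₗ (unstackM (tCoefC η (gaugePair τ fun μ x => coordMat e (ContinuousLinearMap.mulLeftRight ℝ (Matrix m m ℂ) (u k x * U μ x * (u k (τ μ x))ᴴ) (u k x * U μ x * (u k (τ μ x))ᴴ)ᴴ)))
            (tCoefA η (gaugePair τ fun μ x => coordMat e (ContinuousLinearMap.mulLeftRight ℝ (Matrix m m ℂ) (u k x * U μ x * (u k (τ μ x))ᴴ) (u k x * U μ x * (u k (τ μ x))ᴴ)ᴴ))) + NV k ∘ₗ projO none) ∘ₗ mulOp (fun q : (X × ι) × Option (J ⊕ J) => χX k q.1.1)) (fun y y' => R * Real.exp (-(δV * g.dist y y'))) := fun k =>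
    (hasMaj_cutPert_structural_of_local blk hd0 hrV hRN (hχ1 k) (hCloc k) (fun μ x hx => hAloc k μ x hx) (hψχ k) (hNVcut k)).mono fun y y' =>
      mul_le_mul_of_nonneg_right hRle (Real.exp_nonneg _)
  have hV' : ∀ k, HasMaj (BlockNorm.ofBlocks g (blkPair (liftBlk (blk ∘ π) ι))) (BlockNorm.ofBlocks g (liftBlk (blk ∘ π) ι)) (mulOp (fun p : X' × ι => ψX' k p.1) ∘ₗ (unstackM (tCoefC η' (gaugePair τ' fun μ x' => coordMat e (ContinuousLinearMap.mulLeftRight ℝ (Matrix m m ℂ) (u' k x' * U' μ x' * (u' k (τ' μ x'))ᴴ) (u' k x' * U' μ x' * (u' k (τ' μ x'))ᴴ)ᴴ)))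
            (tCoefA η' (gaugePair τ' fun μ x' => coordMat e (ContinuousLinearMap.mulLeftRight ℝ (Matrix m m ℂ) (u' k x' * U' μ x' * (u' k (τ' μ x'))ᴴ) (u' k x' * U' μ x' * (u' k (τ' μ x'))ᴴ)ᴴ))) + NV' k ∘ₗ projO none) ∘ₗ mulOp (fun q : (X' × ι) × Option (J ⊕ J) => χX' k q.1.1)) (fun y y' => R * Real.exp (-(δV * g.dist y y'))) := fun k =>
    (hasMaj_cutPert_structural_of_local (blk ∘ π) hd0 hrV hRN (hχ1' k) (hCloc' k) (fun μ x' hx => hAloc' k μ x' hx) (hψχ' k) (hNVcut' k)).mono fun y y' =>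
      mul_le_mul_of_nonneg_right hRle (Real.exp_nonneg _)
  have hDV : ∀ k, HasMaj (BlockNorm.ofBlocks g (blkPair (liftBlk blk ι))) (BlockNorm.ofBlocks g (liftBlk (blk ∘ π) ι))
      (idef (pull (liftPair (liftMap π ι))) (pull (liftMap π ι)) (mulOp (fun p : X' × ι => ψX' k p.1) ∘ₗ (unstackM (tCoefC η' (gaugePair τ' fun μ x' => coordMat e (ContinuousLinearMap.mulLeftRight ℝ (Matrix m m ℂ) (u' k x' * U' μ x' * (u' k (τ' μ x'))ᴴ) (u' k x' * U' μ x' * (u' k (τ' μ x'))ᴴ)ᴴ)))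
            (tCoefA η' (gaugePair τ' fun μ x' => coordMat e (ContinuousLinearMap.mulLeftRight ℝ (Matrix m m ℂ) (u' k x' * U' μ x' * (u' k (τ' μ x'))ᴴ) (u' k x' * U' μ x' * (u' k (τ' μ x'))ᴴ)ᴴ))) + NV' k ∘ₗ projO none) ∘ₗ mulOp (fun q : (X' × ι) × Option (J ⊕ J) => χX' k q.1.1))
        (mulOp (fun p : X × ι => ψX k p.1) ∘ₗ (unstackM (tCoefC η (gaugePair τ fun μ x => coordMat e (ContinuousLinearMap.mulLeftRight ℝ (Matrix m m ℂ) (u k x * U μ x * (u k (τ μ x))ᴴ) (u k x * U μ x * (u k (τ μ x))ᴴ)ᴴ)))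
            (tCoefA η (gaugePair τ fun μ x => coordMat e (ContinuousLinearMap.mulLeftRight ℝ (Matrix m m ℂ) (u k x * U μ x * (u k (τ μ x))ᴴ) (u k x * U μ x * (u k (τ μ x))ᴴ)ᴴ))) + NV k ∘ₗ projO none) ∘ₗ mulOp (fun q : (X × ι) × Option (J ⊕ J) => χX k q.1.1))) (fun y y' => o * Real.exp (-(δV * g.dist y y'))) := fun k =>
    (hasMaj_idef_cutPert_structural_of_local blk π hd0 hoV hoN (hψχ k) (hψχ' k) (hfitC k) (fun μ x' i => hfitA k μ x' i) (hDNV k)).mono fun y y' =>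
      mul_le_mul_of_nonneg_right hole (Real.exp_nonneg _)
  -- the `W`-rows vanish (`W = 0 = W′`), both grids and their defect
  have hW : ∀ k, HasMaj (BlockNorm.ofBlocks g (liftBlk blk ι)) (BlockNorm.ofBlocks g (liftBlk blk ι)) (commOp (0 : (X × ι → ℝ) →ₗ[ℝ] (X × ι → ℝ)) (fun p : X × ι => hX k p.1) ∘ₗ (projO none ∘ₗ bgPropV (stack (mulOp (fun p : X × ι => χtX k p.1) ∘ₗ N k)
          (fun j => Sum.elim (fun μ => fgrad η⁻¹ (liftEquiv (τ μ) ι)) (fun μ => bgrad η⁻¹ (liftEquiv (τ μ) ι)) j ∘ₗ (mulOp (fun p : X × ι => χtX k p.1) ∘ₗ N k))) (mulOp (fun p : X × ι => ψX k p.1) ∘ₗ (unstackM (tCoefC η (gaugePair τ fun μ x => coordMat e (ContinuousLinearMap.mulLeftRight ℝ (Matrix m m ℂ) (u k x * U μ x * (u k (τ μ x))ᴴ) (u k x * U μ x * (u k (τ μ x))ᴴ)ᴴ)))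
            (tCoefA η (gaugePair τ fun μ x => coordMat e (ContinuousLinearMap.mulLeftRight ℝ (Matrix m m ℂ) (u k x * U μ x * (u k (τ μ x))ᴴ) (u k x * U μ x * (u k (τ μ x))ᴴ)ᴴ))) + NV k ∘ₗ projO none) ∘ₗ mulOp (fun q : (X × ι) × Option (J ⊕ J) => χX k q.1.1))))
      (fun y y' => ind (Sk k) y * ind (Sk k) y' * (θW * Real.exp (-(ρ₂ * g.dist y y')))) := fun k => by
    rw [show commOp (0 : (X × ι → ℝ) →ₗ[ℝ] (X × ι → ℝ)) (fun p : X × ι => hX k p.1) = 0 from by simp [commOp], LinearMap.zero_comp]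
    exact (hasMaj_zero _ _).mono fun y y' => mul_nonneg (mul_nonneg (ind_nonneg _ _) (ind_nonneg _ _)) (mul_nonneg hθW (Real.exp_nonneg _))
  have hW' : ∀ k, HasMaj (BlockNorm.ofBlocks g (liftBlk (blk ∘ π) ι)) (BlockNorm.ofBlocks g (liftBlk (blk ∘ π) ι)) (commOp (0 : (X' × ι → ℝ) →ₗ[ℝ] (X' × ι → ℝ)) (fun p : X' × ι => hX' k p.1) ∘ₗ (projO none ∘ₗ bgPropV (stack (mulOp (fun p : X' × ι => χtX' k p.1) ∘ₗ N' k)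
          (fun j => Sum.elim (fun μ => fgrad η'⁻¹ (liftEquiv (τ' μ) ι)) (fun μ => bgrad η'⁻¹ (liftEquiv (τ' μ) ι)) j ∘ₗ (mulOp (fun p : X' × ι => χtX' k p.1) ∘ₗ N' k))) (mulOp (fun p : X' × ι => ψX' k p.1) ∘ₗ (unstackM (tCoefC η' (gaugePair τ' fun μ x' => coordMat e (ContinuousLinearMap.mulLeftRight ℝ (Matrix m m ℂ) (u' k x' * U' μ x' * (u' k (τ' μ x'))ᴴ) (u' k x' * U' μ x' * (u' k (τ' μ x'))ᴴ)ᴴ)))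
            (tCoefA η' (gaugePair τ' fun μ x' => coordMat e (ContinuousLinearMap.mulLeftRight ℝ (Matrix m m ℂ) (u' k x' * U' μ x' * (u' k (τ' μ x'))ᴴ) (u' k x' * U' μ x' * (u' k (τ' μ x'))ᴴ)ᴴ))) + NV' k ∘ₗ projO none) ∘ₗ mulOp (fun q : (X' × ι) × Option (J ⊕ J) => χX' k q.1.1))))
      (fun y y' => ind (Sk k) y * ind (Sk k) y' * (θW * Real.exp (-(ρ₂ * g.dist y y')))) := fun k => by
    rw [show commOp (0 : (X' × ι → ℝ) →ₗ[ℝ] (X' × ι → ℝ)) (fun p : X' × ι => hX' k p.1) = 0 from by simp [commOp], LinearMap.zero_comp]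
    exact (hasMaj_zero _ _).mono fun y y' => mul_nonneg (mul_nonneg (ind_nonneg _ _) (ind_nonneg _ _)) (mul_nonneg hθW (Real.exp_nonneg _))
  have hDW : ∀ k, HasMaj (BlockNorm.ofBlocks g (liftBlk blk ι)) (BlockNorm.ofBlocks g (liftBlk (blk ∘ π) ι))
      (idef (pull (liftMap π ι)) (pull (liftMap π ι)) (commOp (0 : (X' × ι → ℝ) →ₗ[ℝ] (X' × ι → ℝ)) (fun p : X' × ι => hX' k p.1) ∘ₗ (projO none ∘ₗ bgPropV (stack (mulOp (fun p : X' × ι => χtX' k p.1) ∘ₗ N' k)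
          (fun j => Sum.elim (fun μ => fgrad η'⁻¹ (liftEquiv (τ' μ) ι)) (fun μ => bgrad η'⁻¹ (liftEquiv (τ' μ) ι)) j ∘ₗ (mulOp (fun p : X' × ι => χtX' k p.1) ∘ₗ N' k))) (mulOp (fun p : X' × ι => ψX' k p.1) ∘ₗ (unstackM (tCoefC η' (gaugePair τ' fun μ x' => coordMat e (ContinuousLinearMap.mulLeftRight ℝ (Matrix m m ℂ) (u' k x' * U' μ x' * (u' k (τ' μ x'))ᴴ) (u' k x' * U' μ x' * (u' k (τ' μ x'))ᴴ)ᴴ)))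
            (tCoefA η' (gaugePair τ' fun μ x' => coordMat e (ContinuousLinearMap.mulLeftRight ℝ (Matrix m m ℂ) (u' k x' * U' μ x' * (u' k (τ' μ x'))ᴴ) (u' k x' * U' μ x' * (u' k (τ' μ x'))ᴴ)ᴴ))) + NV' k ∘ₗ projO none) ∘ₗ mulOp (fun q : (X' × ι) × Option (J ⊕ J) => χX' k q.1.1))))
        (commOp (0 : (X × ι → ℝ) →ₗ[ℝ] (X × ι → ℝ)) (fun p : X × ι => hX k p.1) ∘ₗ (projO none ∘ₗ bgPropV (stack (mulOp (fun p : X × ι => χtX k p.1) ∘ₗ N k)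
          (fun j => Sum.elim (fun μ => fgrad η⁻¹ (liftEquiv (τ μ) ι)) (fun μ => bgrad η⁻¹ (liftEquiv (τ μ) ι)) j ∘ₗ (mulOp (fun p : X × ι => χtX k p.1) ∘ₗ N k))) (mulOp (fun p : X × ι => ψX k p.1) ∘ₗ (unstackM (tCoefC η (gaugePair τ fun μ x => coordMat e (ContinuousLinearMap.mulLeftRight ℝ (Matrix m m ℂ) (u k x * U μ x * (u k (τ μ x))ᴴ) (u k x * U μ x * (u k (τ μ x))ᴴ)ᴴ)))
            (tCoefA η (gaugePair τ fun μ x => coordMat e (ContinuousLinearMap.mulLeftRight ℝ (Matrix m m ℂ) (u k x * U μ x * (u k (τ μ x))ᴴ) (u k x * U μ x * (u k (τ μ x))ᴴ)ᴴ))) + NV k ∘ₗ projO none) ∘ₗ mulOp (fun q : (X × ι) × Option (J ⊕ J) => χX k q.1.1)))))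
      (fun y y' => ind (Sk k) y * ind (Sk k) y' * (rW * Real.exp (-(ρ₂ * g.dist y y')))) := fun k =>
    hasMaj_idef_of_eq_zero (pull (liftMap π ι)) (by rw [show commOp (0 : (X' × ι → ℝ) →ₗ[ℝ] (X' × ι → ℝ)) (fun p : X' × ι => hX' k p.1) = 0 from by simp [commOp], LinearMap.zero_comp])
      (by rw [show commOp (0 : (X × ι → ℝ) →ₗ[ℝ] (X × ι → ℝ)) (fun p : X × ι => hX k p.1) = 0 from by simp [commOp], LinearMap.zero_comp])
      fun y y' => mul_nonneg (mul_nonneg (ind_nonneg _ _) (ind_nonneg _ _)) (mul_nonneg hrW (Real.exp_nonneg _))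
  -- the far-defect rows (file 49: `M_hFX = 0`; file 50: `[F, M_h]X` from the far letters) and their η-defects (file 50), both grids
  have hFX := fun k => hasMaj_mulOp_farDefect_smoothCutDressed blk τ η⁻¹ (Vf := (unstackM (tCoefC η (gaugePair τ fun μ x => coordMat e (ContinuousLinearMap.mulLeftRight ℝ (Matrix m m ℂ) (u k x * U μ x * (u k (τ μ x))ᴴ) (u k x * U μ x * (u k (τ μ x))ᴴ)ᴴ)))
            (tCoefA η (gaugePair τ fun μ x => coordMat e (ContinuousLinearMap.mulLeftRight ℝ (Matrix m m ℂ) (u k x * U μ x * (u k (τ μ x))ᴴ) (u k x * U μ x * (u k (τ μ x))ᴴ)ᴴ))) + NV k ∘ₗ projO none)) htri hd hrow hσ hβ hβ₁ hct hR hcr hσρ hρ₁V hρ₁G hρ₂ hρ₂₁ (hχt k) (hdχt k) (hdχtb k) (hsub k) (hχ k) (hs k)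
    (hsb k) (hdd k) (hddb k) (hs2 k) (hsb2 k) (hdd2 k) (hddb2 k) (hcut k) (hcutF k) (hcutB k) (hV k) hq (hhψ k) ρ₃
  have hFX' := fun k => hasMaj_mulOp_farDefect_smoothCutDressed (blk ∘ π) τ' η'⁻¹ (Vf := (unstackM (tCoefC η' (gaugePair τ' fun μ x' => coordMat e (ContinuousLinearMap.mulLeftRight ℝ (Matrix m m ℂ) (u' k x' * U' μ x' * (u' k (τ' μ x'))ᴴ) (u' k x' * U' μ x' * (u' k (τ' μ x'))ᴴ)ᴴ)))
            (tCoefA η' (gaugePair τ' fun μ x' => coordMat e (ContinuousLinearMap.mulLeftRight ℝ (Matrix m m ℂ) (u' k x' * U' μ x' * (u' k (τ' μ x'))ᴴ) (u' k x' * U' μ x' * (u' k (τ' μ x'))ᴴ)ᴴ))) + NV' k ∘ₗ projO none)) htri hd hrow hσ hβ hβ₁ hct hR hcr hσρ hρ₁V hρ₁G hρ₂ hρ₂₁ (hχt' k) (hdχt' k) (hdχtb' k) (hsub' k)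
    (hχ' k) (hs' k) (hsb' k) (hdd' k) (hddb' k) (hs2' k) (hsb2' k) (hdd2' k) (hddb2' k) (hcut' k) (hcutF' k) (hcutB' k) (hV' k) hq (hhψf k) ρ₃
  have hFK := fun k => hasMaj_commOp_farDefect_structural blk τ η⁻¹ (NV := NV k) (Cc := tCoefC η (gaugePair τ fun μ x => coordMat e (ContinuousLinearMap.mulLeftRight ℝ (Matrix m m ℂ) (u k x * U μ x * (u k (τ μ x))ᴴ) (u k x * U μ x * (u k (τ μ x))ᴴ)ᴴ)))
    (Ac := tCoefA η (gaugePair τ fun μ x => coordMat e (ContinuousLinearMap.mulLeftRight ℝ (Matrix m m ℂ) (u k x * U μ x * (u k (τ μ x))ᴴ) (u k x * U μ x * (u k (τ μ x))ᴴ)ᴴ))) htri hd hrow hσ hβ hβ₁ hct hR hcr hσρ hρ₁V hρ₁G hρ₂ hρ₂₁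
    (hSχ k) (hSψ k) (hχt k) (hdχt k) (hdχtb k) (hsub k) (hχ k) (hs k) (hsb k) (hdd k) (hddb k) (hs2 k) (hsb2 k) (hdd2 k) (hddb2 k) (hNψ k) (hcut k) (hcutF k) (hcutB k) (hV k) hq hθF hρ₃ hρ₃₂ hρF
    (hhabs k) (hhψ k) (hχh k) (hhs' k) (hhsb' k) (hhdd' k) (hhddb' k) (hψχ k) (hfarN k)
  have hFK' := fun k => hasMaj_commOp_farDefect_structural (blk ∘ π) τ' η'⁻¹ (NV := NV' k) (Cc := tCoefC η' (gaugePair τ' fun μ x' => coordMat e (ContinuousLinearMap.mulLeftRight ℝ (Matrix m m ℂ) (u' k x' * U' μ x' * (u' k (τ' μ x'))ᴴ) (u' k x' * U' μ x' * (u' k (τ' μ x'))ᴴ)ᴴ)))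
    (Ac := tCoefA η' (gaugePair τ' fun μ x' => coordMat e (ContinuousLinearMap.mulLeftRight ℝ (Matrix m m ℂ) (u' k x' * U' μ x' * (u' k (τ' μ x'))ᴴ) (u' k x' * U' μ x' * (u' k (τ' μ x'))ᴴ)ᴴ))) htri hd hrow hσ hβ hβ₁ hct hR hcr hσρ hρ₁V hρ₁G hρ₂ hρ₂₁
    (hSχ' k) (hSψ' k) (hχt' k) (hdχt' k) (hdχtb' k) (hsub' k) (hχ' k) (hs' k) (hsb' k) (hdd' k) (hddb' k) (hs2' k) (hsb2' k) (hdd2' k) (hddb2' k) (hNψ' k) (hcut' k) (hcutF' k) (hcutB' k) (hV' k) hq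
    hθF hρ₃ hρ₃₂ hρF (hhabs' k) (hhψf k) (hχhf k) (hhsf k) (hhsbf k) (hhddf k) (hhddbf k) (hψχ' k) (hfarN' k)
  have hDFK := fun k => hasMaj_idef_commOp_farDefect_structural blk π τ τ' η⁻¹ η'⁻¹ (NV := NV k) (NV' := NV' k) (Cc := tCoefC η (gaugePair τ fun μ x => coordMat e (ContinuousLinearMap.mulLeftRight ℝ (Matrix m m ℂ) (u k x * U μ x * (u k (τ μ x))ᴴ) (u k x * U μ x * (u k (τ μ x))ᴴ)ᴴ)))
    (Ac := tCoefA η (gaugePair τ fun μ x => coordMat e (ContinuousLinearMap.mulLeftRight ℝ (Matrix m m ℂ) (u k x * U μ x * (u k (τ μ x))ᴴ) (u k x * U μ x * (u k (τ μ x))ᴴ)ᴴ)))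
    (Cc' := tCoefC η' (gaugePair τ' fun μ x' => coordMat e (ContinuousLinearMap.mulLeftRight ℝ (Matrix m m ℂ) (u' k x' * U' μ x' * (u' k (τ' μ x'))ᴴ) (u' k x' * U' μ x' * (u' k (τ' μ x'))ᴴ)ᴴ)))
    (Ac' := tCoefA η' (gaugePair τ' fun μ x' => coordMat e (ContinuousLinearMap.mulLeftRight ℝ (Matrix m m ℂ) (u' k x' * U' μ x' * (u' k (τ' μ x'))ᴴ) (u' k x' * U' μ x' * (u' k (τ' μ x'))ᴴ)ᴴ))) htri hd hrow hσ hcr hβ hβ₁ hct hm₀ hm₁ hoχ hoχ₁ hoχ₂ hR ho hσρ hρ₁V hρ₁G hρ₂ hρ₂₁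
    (hSχ k) (hSψ k) (hSχ' k) (hSψ' k) (hχt k) (hdχt k) (hdχtb k) (hsub k) (hχ k) (hs k) (hsb k) (hdd k) (hddb k) (hNψ k) (hχt' k) (hdχt' k) (hdχtb' k) (hsub' k) (hχ' k) (hs' k) (hsb' k)
    (hdd' k) (hddb' k) (hNψ' k) (hfitχ k) (hfit₁ k) (hfit₁b k) (hfit₂ k) (hfit₂b k) (hcut k) (hcutF k) (hcutB k) (hcut' k) (hcutF' k) (hcutB' k) (hDcut k) (hDcutF k) (hDcutB k) (hV k)
    (hV' k) (hDV k) (hs2 k) (hsb2 k) (hdd2 k) (hddb2 k) (hs2' k) (hsb2' k) (hdd2' k) (hddb2' k) (hhabs k) (hhabs' k) (hfh k) hoo (hhψ k) (hχh k) (hhs' k) (hhsb' k) (hhdd' k) (hhddb' k)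
    (hψχ k) (hhψf k) (hχhf k) (hhsf k) (hhsbf k) (hhddf k) (hhddbf k) (hψχ' k) hθF hrD hρ₃ hρ₃₂ hρF (hfarN' k) (hDfarN k) hq
  have hDFX := fun k => hasMaj_idef_mulOp_farDefect_structural blk π τ τ' η⁻¹ η'⁻¹ (NV := NV k) (NV' := NV' k) (Cc := tCoefC η (gaugePair τ fun μ x => coordMat e (ContinuousLinearMap.mulLeftRight ℝ (Matrix m m ℂ) (u k x * U μ x * (u k (τ μ x))ᴴ) (u k x * U μ x * (u k (τ μ x))ᴴ)ᴴ)))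
    (Ac := tCoefA η (gaugePair τ fun μ x => coordMat e (ContinuousLinearMap.mulLeftRight ℝ (Matrix m m ℂ) (u k x * U μ x * (u k (τ μ x))ᴴ) (u k x * U μ x * (u k (τ μ x))ᴴ)ᴴ)))
    (Cc' := tCoefC η' (gaugePair τ' fun μ x' => coordMat e (ContinuousLinearMap.mulLeftRight ℝ (Matrix m m ℂ) (u' k x' * U' μ x' * (u' k (τ' μ x'))ᴴ) (u' k x' * U' μ x' * (u' k (τ' μ x'))ᴴ)ᴴ)))
    (Ac' := tCoefA η' (gaugePair τ' fun μ x' => coordMat e (ContinuousLinearMap.mulLeftRight ℝ (Matrix m m ℂ) (u' k x' * U' μ x' * (u' k (τ' μ x'))ᴴ) (u' k x' * U' μ x' * (u' k (τ' μ x'))ᴴ)ᴴ))) htri hd hrow hσ hβ hβ₁ hct hR hcr hσρ hρ₁V hρ₁G hρ₂ hρ₂₁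
    (hχt k) (hdχt k) (hdχtb k) (hsub k) (hχ k) (hs k) (hsb k) (hdd k) (hddb k) (hs2 k) (hsb2 k) (hdd2 k) (hddb2 k) (hcut k) (hcutF k) (hcutB k) (hV k) hq (hχt' k) (hdχt' k) (hdχtb' k)
    (hsub' k) (hχ' k) (hs' k) (hsb' k) (hdd' k) (hddb' k) (hs2' k) (hsb2' k) (hdd2' k) (hddb2' k) (hcut' k) (hcutF' k) (hcutB' k) (hV' k) (hhψ k) (hhψf k) ρ₃
  exact hasMaj_idef_glueInv_smoothCutDressed_localGauges blk π τ τ' η⁻¹ η'⁻¹ htri hd hd0 hsymm hrow hσ hcr hβ hβ₁ hct hm₀ hm₁ hoχ hoχ₁ hoχ₂ hR ho hσρ hρ₁V hρ₁G hρ₂ hρ₂₁ hρ₂T hρ₃ hρ₃₂ hρ₃V hρ₃N hσρ₃ hε hc₁ hc₂ ho₁ ho₂ hrW hθW hcN hrN hℓ hω hd₁ hoo hε₀ hrF hNov hn hn' hSχ hSψ hSχ' hSψ' hχt hdχt hdχtb hsub hχ hs hsb hdd hddb hNψ hχt' hdχt' hdχtb' hsub' hχ' hs' hsb' hdd' hddb'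 hNψ' hfitχ hfit₁ hfit₁b hfit₂ hfit₂b hcut hcutF hcutB hcut' hcutF' hcutB' hDcut hDcutF hDcutB hs2 hsb2 hdd2 hddb2 hs2' hsb2' hdd2' hddb2' hV hV' hDV hq hh1 hh1b hh1' hh1b' hh2' hf1 hf1b hf2 hLip hrh hrh' hfh hstep hstep' hDW hKN' hDKN hh2 hW hW' hKN hhabs hhabs' hhcut hhcut' hN hT hT' hDT hug hug' hugf hugf' hfitW hfitWT hoW hθF' (le_refl (0:ℝ)) hrFK' (le_refl (0:ℝ)) hcov hcov' hFK hFK' hFX hFX' hDFK hDFX hq'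

end Summit.QuantumFields.YangMills.BalabanUVNodes.N15.CurvedSpecies

end
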